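import Literature.Topology.FourManifolds.HomotopySpheresStablyParallelizableBoundary
import Literature.Topology.FourManifolds.HomotopySpheresStablyParallelizableSeven
import Literature.AlgebraicTopology.Homotopy.CubeHomotopyExtension
import HarnessLib

/-!
# `π_D(SO(D)) → π_D(SO(D + 1))` is onto for `D` even (Steenrod §23.4); the fact `⇐ π₆(SO(6), 1) = 0`

Topic `Literature/Topology/FourManifolds`; third of the sibling files `…Loops`, `…Boundary`,
`…Even` towards the named fact
`Literature.Topology.FourManifolds.Bott1959_sphereMapsToStableFramesExtend_six` (R. Bott, *The
stable homotopy of the classical groups*, Ann. of Math. 70 (1959), §1 (1.5): `π₆(O) = 0`; in the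
tree `↔ π₆(SO(8), 1) = 0 ⇐ π₆(SO(7), 1) = 0`, files `…Orthogonal.lean`, `…Seven.lean`).

N. Steenrod, *The Topology of Fibre Bundles* (1951), §23.4 with §23.3: for the bundle
`SO(m + 1) → SO(m + 2) → Sᵐ⁺¹` the boundary `Δ ι_{m+1} ∈ πₘ(SO(m + 1))` of the identity class
is the class of the characteristic map `T_{m+1}(u) = ρ_u ρ_{e}` (a product of two reflections),
and `p'_* Δ ι_{m+1} = (1 + (-1)^{m+1}) ι_m` in `πₘ(Sᵐ) = ℤ`; hence for `m + 1` EVEN, `Δ` is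
injective on `π_{m+1}(Sᵐ⁺¹) = ℤ`, `p_* = 0` on `π_{m+1}(SO(m + 2))`, and
`ι_* : π_{m+1}(SO(m + 1)) → π_{m+1}(SO(m + 2))` is ONTO. This file carries this out for Mathlib's
cubical homotopy groups, feeding the vanishing criterion of `…Boundary.lean`
(`subsingleton_homotopyGroup_succ_of_criterion`) with explicit data, everything PROVED:

* §1 coordinate symmetries of `Sᵐ ⊂ ℝᵐ⁺¹` (`negCoords`, `swapCoords`) and the reflection map
  `gMap u = ρ_u e₀ = e₀ - 2u₀ u` (`Sᵐ → Sᵐ`, Steenrod's `p' T`);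
* §2 the **stereographic collapse** `pc : (Iᵐ, ∂Iᵐ) → (Sᵐ, e_m)` (centred cube coordinates
  `y = 2x - 1` — the tree's `CubeHEP.cubeToBall` —, `v = y / (1 - ‖y‖∞)`, inverse stereographic
  projection from `e_m`): continuous,
  `∂Iᵐ ↦ e_m`, injective off `∂Iᵐ`, onto, and equivariant (`x_j ↦ 1 - x_j` ↔ `u_j ↦ -u_j`);
* §3 the loops (`m = n + 1`): `T(x) = ρ_{pc x} ρ_{e_m} ∈ SO(m + 1)` (based, as `pc(∂Iᵐ) = e_m`),
  its projection `p' ∘ T = gMap ∘ pc = τ₊ ∗ τ₋` split along `x₀`, the relation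
  `τ₋ = M ∘ τ₊ ∘ (x₀ ↦ 1 - x₀)` with `M = -ρ_{e₀}`, and `[τ₋] = [τ₊]` for `m` odd — `M` is the composite of the `m - 1` coordinate
  reflections in `e₁, …, e_{m-1}` (each acting on `[τ₊]` as a cube reflection, i.e. by inversion)
  and the reflection in `e_m`, which acts by inversion on ALL of `πₘ(Sᵐ, e₀) ≅ ℤ` because it does
  so on the essential class of the swapped collapse `swap ∘ pc` (`…Loops`:
  `map_eq_inv_of_map_eq_inv`, `cls_ne_one_of_surjective`); hence
  `[p' T] = [τ₊]² ≠ 1` (`τ₊` is onto and injective off the boundary, so essential) — this is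
  Steenrod's `p'_* Δ ι = 2 ι_m ≠ 0`, §23.4, for `m + 1` even;
* §4 the **explicit normalised lift** `Λ(t, x) = ρ_{(1-t)e₀ + t·pc x} ρ_{(1-t)e₀ + t·e_m}` in
  `SO(m + 2)` (`1` for `t = 0` and over `∂Iᵐ`, `ι(T x)` for `t = 1`; Steenrod §23.3: the
  contraction of `T_{m+1}` in `R_{m+1}`), so that `[T] = Δ[p ∘ Λ]`;
* §5 **Theorem** (`surjective_homotopyGroupMap_inclSO_of_even`,
  `subsingleton_homotopyGroup_specialOrthogonalGroup_succ_of_even`; the file is parametrised by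
  `n` with `m = n + 1`, `D = m + 1 = n + 2` the even dimension): for `n` even, `n ≥ 2`,
  `ι_* : π_{n+2}(SO(n + 2), 1) → π_{n+2}(SO(n + 3), 1)` is onto and
  `π_{n+2}(SO(n + 2), 1) = 0 ⇒ π_{n+2}(SO(n + 3), 1) = 0`; with `n = 4` and `…Seven.lean`:
  **`π₆(SO(6), 1) = 0` implies `Bott1959_sphereMapsToStableFramesExtend_six`**
  (`Bott1959_sphereMapsToStableFramesExtend_six_of_specialOrthogonalGroup_six`, in the root
  namespace `Literature.Topology.FourManifolds` next to its siblings).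

What is NOT here: `π₆(SO(6)) = 0` itself (`SO(6) ≅ SU(4)/±1` and `π₆(SU(4)) = π₆(U) = 0` is
complex Bott periodicity; no elementary proof is known) — the named fact stays a named fact.

## References

* N. Steenrod, *The Topology of Fibre Bundles*, Princeton (1951), §23.3–23.4 (and §17, §22).
  [Steenrod1951]
* R. Bott, *The stable homotopy of the classical groups*, Ann. of Math. 70 (1959), §1 (1.5),
  p. 315. [Bott1959]
* A. Hatcher, *Algebraic Topology*, CUP (2002), §4.2 Example 4.55, §4.1 p. 340. [HatcherAT2002]
* M. Kervaire, J. Milnor, *Groups of homotopy spheres I*, Ann. of Math. 77 (1963), p. 508.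
  [KervaireMilnorAnnals1963]
-/

noncomputable section

open scoped unitInterval Topology Topology.Homotopy Real
open Matrix Set Metric Literature.AlgebraicTopology.Homotopy

namespace Literature.Topology.FourManifolds

namespace EvenSphere

open SOTransport

/-! ### 1. Coordinates on `Sᵐ ⊂ ℝᵐ⁺¹`: sign changes, the swap, the reflection map `gMap` -/

section Coordinates

variable {m : ℕ}

/-- `∑ uᵢ² = 1` on the unit sphere, in coordinates. [folklore] -/
theorem sum_sq_ofLp_sphere (u : sphere (0 : EuclideanSpace ℝ (Fin (m + 1))) 1) :
    ∑ i, (WithLp.ofLp (u : EuclideanSpace ℝ (Fin (m + 1))) i) ^ 2 = 1 := by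
  have h := dotProduct_self_sphere u
  simpa only [dotProduct, sq] using h

/-- The norm of a coordinate vector. [folklore] -/
theorem norm_toLp_eq_sqrt (v : Fin (m + 1) → ℝ) :
    ‖(WithLp.toLp 2 v : EuclideanSpace ℝ (Fin (m + 1)))‖ = √(∑ i, v i ^ 2) := by
  rw [EuclideanSpace.norm_eq]
  congr 1
  exact Finset.sum_congr rfl fun i _ => by simp [sq_abs]

/-- A coordinate vector with `∑ vᵢ² = 1` is a point of the unit sphere. [folklore] -/
theorem toLp_mem_sphere_of {v : Fin (m + 1) → ℝ} (h : ∑ i, v i ^ 2 = 1) :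
    (WithLp.toLp 2 v : EuclideanSpace ℝ (Fin (m + 1))) ∈ sphere (0 : EuclideanSpace ℝ (Fin (m + 1))) 1 := by
  rw [mem_sphere_zero_iff_norm, norm_toLp_eq_sqrt, h, Real.sqrt_one]

/-- The point of the unit sphere with a given unit coordinate vector. [folklore] -/
def mkS (v : Fin (m + 1) → ℝ) (h : ∑ i, v i ^ 2 = 1) : sphere (0 : EuclideanSpace ℝ (Fin (m + 1))) 1 :=
  ⟨WithLp.toLp 2 v, toLp_mem_sphere_of h⟩

/-- Coordinates of `mkS v h`. [folklore] -/
@[simp] theorem ofLp_mkS (v : Fin (m + 1) → ℝ) (h : ∑ i, v i ^ 2 = 1) :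
    WithLp.ofLp (mkS v h : EuclideanSpace ℝ (Fin (m + 1))) = v := rfl

/-- Points of the sphere are equal iff their coordinates are. [folklore] -/
theorem sphere_ext {u u' : sphere (0 : EuclideanSpace ℝ (Fin (m + 1))) 1}
    (h : ∀ i, WithLp.ofLp (u : EuclideanSpace ℝ (Fin (m + 1))) i =
      WithLp.ofLp (u' : EuclideanSpace ℝ (Fin (m + 1))) i) : u = u' :=
  Subtype.ext (WithLp.ofLp_injective 2 (funext h))

/-- The coordinate functions of the sphere are continuous. [folklore] -/
theorem continuous_coord (i : Fin (m + 1)) :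
    Continuous fun u : sphere (0 : EuclideanSpace ℝ (Fin (m + 1))) 1 =>
      WithLp.ofLp (u : EuclideanSpace ℝ (Fin (m + 1))) i :=
  (continuous_apply i).comp ((PiLp.continuous_ofLp 2 _).comp continuous_subtype_val)

/-- Each coordinate of a point of the unit sphere has square `≤ 1`. [folklore] -/
theorem sq_coord_le_one (u : sphere (0 : EuclideanSpace ℝ (Fin (m + 1))) 1) (i : Fin (m + 1)) :
    (WithLp.ofLp (u : EuclideanSpace ℝ (Fin (m + 1))) i) ^ 2 ≤ 1 :=
  (Finset.single_le_sum (f := fun j => (WithLp.ofLp (u : EuclideanSpace ℝ (Fin (m + 1))) j) ^ 2)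
    (fun _ _ => sq_nonneg _) (Finset.mem_univ i)).trans_eq (sum_sq_ofLp_sphere u)

/-- Sign change of the coordinates in `S`, on coordinate vectors. [folklore] -/
def negVec (S : Finset (Fin (m + 1))) (v : Fin (m + 1) → ℝ) : Fin (m + 1) → ℝ :=
  fun i => if i ∈ S then -v i else v i

/-- Squares are unchanged by sign changes. [folklore] -/
theorem negVec_sq (S : Finset (Fin (m + 1))) (v : Fin (m + 1) → ℝ) (i : Fin (m + 1)) :
    negVec S v i ^ 2 = v i ^ 2 := by
  unfold negVec
  split_ifs <;> ring

/-- **Sign change of the coordinates in `S`**, a self-map of `Sᵐ` (a product of `|S|` coordinate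
reflections). [folklore] -/
def negCoords (S : Finset (Fin (m + 1))) :
    C(sphere (0 : EuclideanSpace ℝ (Fin (m + 1))) 1, sphere (0 : EuclideanSpace ℝ (Fin (m + 1))) 1) where
  toFun u := mkS (negVec S (WithLp.ofLp (u : EuclideanSpace ℝ (Fin (m + 1)))))
    (by simp_rw [negVec_sq]; exact sum_sq_ofLp_sphere u)
  continuous_toFun := by
    refine Continuous.subtype_mk ((PiLp.continuous_toLp 2 _).comp (continuous_pi fun i => ?_)) _
    unfold negVec
    split_ifs
    · exact (continuous_coord i).neg
    · exact continuous_coord i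

/-- Coordinates of `negCoords S u`. [folklore] -/
@[simp] theorem ofLp_negCoords (S : Finset (Fin (m + 1))) (u : sphere (0 : EuclideanSpace ℝ (Fin (m + 1))) 1)
    (i : Fin (m + 1)) :
    WithLp.ofLp (negCoords S u : EuclideanSpace ℝ (Fin (m + 1))) i =
      if i ∈ S then -WithLp.ofLp (u : EuclideanSpace ℝ (Fin (m + 1))) i
      else WithLp.ofLp (u : EuclideanSpace ℝ (Fin (m + 1))) i := rfl

/-- `negCoords S` is an involution. [folklore] -/
theorem negCoords_negCoords (S : Finset (Fin (m + 1))) (u : sphere (0 : EuclideanSpace ℝ (Fin (m + 1))) 1) :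
    negCoords S (negCoords S u) = u :=
  sphere_ext fun i => by
    simp only [ofLp_negCoords]
    split_ifs <;> ring

/-- Sign changes on disjoint sets of coordinates compose to the sign change on the union.
[folklore] -/
theorem negCoords_negCoords_of_disjoint {S S' : Finset (Fin (m + 1))} (h : Disjoint S S')
    (u : sphere (0 : EuclideanSpace ℝ (Fin (m + 1))) 1) :
    negCoords S (negCoords S' u) = negCoords (S ∪ S') u :=
  sphere_ext fun i => by
    simp only [ofLp_negCoords, Finset.mem_union]
    by_cases hi : i ∈ S <;> by_cases hi' : i ∈ S'
    · exact absurd (Finset.mem_inter.mpr ⟨hi, hi'⟩) (by rw [Finset.disjoint_iff_inter_eq_empty.mp h]; simp)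
    · simp [hi, hi']
    · simp [hi, hi']
    · simp [hi, hi']

/-- A sign change not involving the coordinate `0` fixes the pole `e₀`. [folklore] -/
theorem negCoords_pole {S : Finset (Fin (m + 1))} (h0 : (0 : Fin (m + 1)) ∉ S) :
    negCoords S (pole m) = pole m :=
  sphere_ext fun i => by
    simp only [ofLp_negCoords, ofLp_pole]
    split_ifs with hi
    · have hi0 : i ≠ 0 := fun h => h0 (h ▸ hi)
      rw [Pi.single_eq_of_ne hi0, neg_zero]
    · rfl

/-- **The swap of the coordinates `0` and `m`**, a self-map of `Sᵐ`. [folklore] -/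
def swapCoords :
    C(sphere (0 : EuclideanSpace ℝ (Fin (m + 1))) 1, sphere (0 : EuclideanSpace ℝ (Fin (m + 1))) 1) where
  toFun u := mkS (fun i => WithLp.ofLp (u : EuclideanSpace ℝ (Fin (m + 1))) (Equiv.swap 0 (Fin.last m) i))
    (by rw [Equiv.sum_comp (Equiv.swap 0 (Fin.last m))
          (fun i => (WithLp.ofLp (u : EuclideanSpace ℝ (Fin (m + 1))) i) ^ 2)]
        exact sum_sq_ofLp_sphere u)
  continuous_toFun := Continuous.subtype_mk ((PiLp.continuous_toLp 2 _).comp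
    (continuous_pi fun i => continuous_coord _)) _

/-- Coordinates of `swapCoords u`. [folklore] -/
@[simp] theorem ofLp_swapCoords (u : sphere (0 : EuclideanSpace ℝ (Fin (m + 1))) 1) (i : Fin (m + 1)) :
    WithLp.ofLp (swapCoords u : EuclideanSpace ℝ (Fin (m + 1))) i =
      WithLp.ofLp (u : EuclideanSpace ℝ (Fin (m + 1))) (Equiv.swap 0 (Fin.last m) i) := rfl

/-- The reflection in `e_m` is conjugate by the swap to the reflection in `e₀`:
`R_m ∘ swap = swap ∘ R₀`. [folklore] -/
theorem negCoords_last_swapCoords (u : sphere (0 : EuclideanSpace ℝ (Fin (m + 1))) 1) :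
    negCoords {Fin.last m} (swapCoords u) = swapCoords (negCoords {0} u) :=
  sphere_ext fun i => by
    simp only [ofLp_negCoords, ofLp_swapCoords, Finset.mem_singleton]
    have h : i = Fin.last m ↔ Equiv.swap 0 (Fin.last m) i = 0 := by
      rw [Equiv.swap_apply_eq_iff, Equiv.swap_apply_left]
    by_cases hi : i = Fin.last m
    · rw [if_pos hi, if_pos (h.mp hi)]
    · rw [if_neg hi, if_neg (fun h' => hi (h.mpr h'))]

/-- The point `e_m = (0, …, 0, 1)` of `Sᵐ` (the base point of the collapse `pc`). [folklore] -/
def lastPt (m : ℕ) : sphere (0 : EuclideanSpace ℝ (Fin (m + 1))) 1 :=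
  mkS (Pi.single (Fin.last m) 1) (by
    rw [Finset.sum_eq_single (Fin.last m) (fun i _ hi => by simp [hi]) (by simp)]
    simp)

/-- Coordinates of `e_m`. [folklore] -/
@[simp] theorem ofLp_lastPt : WithLp.ofLp (lastPt m : EuclideanSpace ℝ (Fin (m + 1))) = Pi.single (Fin.last m) 1 :=
  rfl

/-- The swap takes `e_m` to `e₀`. [folklore] -/
theorem swapCoords_lastPt : swapCoords (lastPt m) = pole m :=
  sphere_ext fun i => by
    simp only [ofLp_swapCoords, ofLp_lastPt, ofLp_pole]
    by_cases hi : i = 0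
    · subst hi
      simp
    · rw [Pi.single_eq_of_ne hi, Pi.single_eq_of_ne]
      intro h
      apply hi
      rw [Equiv.swap_apply_eq_iff] at h
      simpa using h

/-- `ρᵥ e₀ = e₀ - 2 v₀ v` for a unit vector `v`, in coordinates. [folklore] -/
theorem reflMat_mulVec_single_zero {v : Fin (m + 1) → ℝ} (hv : v ⬝ᵥ v = 1) :
    reflMat v *ᵥ Pi.single 0 1 = fun i => (Pi.single 0 1 : Fin (m + 1) → ℝ) i - 2 * v 0 * v i := by
  rw [reflMat_mulVec, hv, div_one, dotProduct_single, mul_one]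
  funext i
  simp [mul_assoc]

/-- **The reflection map `G(u) = ρ_u e₀ = e₀ - 2u₀u`** of `Sᵐ` (Steenrod §23.3–23.4: `p' T(u)`,
the image of `e₀` under the reflection in `u^⊥`; it factors through `ℝPᵐ` and has degree
`1 + (-1)^{m+1}`). [cite: Steenrod1951, §23.4] -/
def gMap : C(sphere (0 : EuclideanSpace ℝ (Fin (m + 1))) 1, sphere (0 : EuclideanSpace ℝ (Fin (m + 1))) 1) where
  toFun u := ⟨mvE (reflMat (WithLp.ofLp (u : EuclideanSpace ℝ (Fin (m + 1))))) (pole m), by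
    rw [mem_sphere_zero_iff_norm, norm_mvE_of_mem (reflMat_mem_orthogonalGroup
      (by rw [dotProduct_self_sphere]; exact one_ne_zero)), norm_eq_of_mem_sphere]⟩
  continuous_toFun := by
    refine Continuous.subtype_mk (continuous_mvE.comp (Continuous.prodMk ?_ continuous_const)) _
    exact continuous_reflMat ((PiLp.continuous_ofLp 2 _).comp continuous_subtype_val)
      fun u => by rw [dotProduct_self_sphere]; exact one_ne_zero

/-- Coordinates of `G(u)`: `δ_{i0} - 2 u₀ uᵢ`. [cite: Steenrod1951, §23.4] -/
theorem ofLp_gMap (u : sphere (0 : EuclideanSpace ℝ (Fin (m + 1))) 1) (i : Fin (m + 1)) :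
    WithLp.ofLp (gMap u : EuclideanSpace ℝ (Fin (m + 1))) i =
      (Pi.single 0 1 : Fin (m + 1) → ℝ) i - 2 * WithLp.ofLp (u : EuclideanSpace ℝ (Fin (m + 1))) 0 *
        WithLp.ofLp (u : EuclideanSpace ℝ (Fin (m + 1))) i := by
  change (reflMat (WithLp.ofLp (u : EuclideanSpace ℝ (Fin (m + 1)))) *ᵥ
    WithLp.ofLp (pole m : EuclideanSpace ℝ (Fin (m + 1)))) i = _
  rw [ofLp_pole, reflMat_mulVec_single_zero (dotProduct_self_sphere u)]

/-- `G(u) = e₀` when `u₀ = 0`. [folklore] -/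
theorem gMap_eq_pole_of {u : sphere (0 : EuclideanSpace ℝ (Fin (m + 1))) 1}
    (h : WithLp.ofLp (u : EuclideanSpace ℝ (Fin (m + 1))) 0 = 0) : gMap u = pole m :=
  sphere_ext fun i => by rw [ofLp_gMap, h, ofLp_pole]; ring

/-- `G` commutes with sign changes not involving the coordinate `0`. [folklore] -/
theorem gMap_negCoords_of_not_mem {S : Finset (Fin (m + 1))} (h0 : (0 : Fin (m + 1)) ∉ S)
    (u : sphere (0 : EuclideanSpace ℝ (Fin (m + 1))) 1) :
    gMap (negCoords S u) = negCoords S (gMap u) :=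
  sphere_ext fun i => by
    simp only [ofLp_gMap, ofLp_negCoords, if_neg h0]
    split_ifs with hi
    · have hi0 : i ≠ 0 := fun h => h0 (h ▸ hi)
      rw [Pi.single_eq_of_ne hi0]
      ring
    · rfl

/-- `G ∘ R₀ = M ∘ G` with `R₀` the reflection in `e₀` and `M = -R₀` the sign change of all the
other coordinates. [folklore] -/
theorem gMap_negCoords_zero (u : sphere (0 : EuclideanSpace ℝ (Fin (m + 1))) 1) :
    gMap (negCoords {0} u) = negCoords (Finset.univ.erase 0) (gMap u) :=
  sphere_ext fun i => by
    simp only [ofLp_gMap, ofLp_negCoords, Finset.mem_singleton, Finset.mem_erase, Finset.mem_univ,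
      and_true, if_true]
    by_cases hi : i = 0
    · subst hi
      simp
    · rw [if_neg hi, if_pos hi, Pi.single_eq_of_ne hi]
      ring

/-- **`G` is injective on the closed hemisphere `u₀ ≤ 0` away from the equator**: if
`G u = G u'` with `u₀, u'₀ ≤ 0` then `u = u'` or both lie on the equator `u₀ = u'₀ = 0`.
[folklore] -/
theorem gMap_eq_gMap_imp {u u' : sphere (0 : EuclideanSpace ℝ (Fin (m + 1))) 1} (h : gMap u = gMap u')
    (hu : WithLp.ofLp (u : EuclideanSpace ℝ (Fin (m + 1))) 0 ≤ 0)
    (hu' : WithLp.ofLp (u' : EuclideanSpace ℝ (Fin (m + 1))) 0 ≤ 0) :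
    u = u' ∨ (WithLp.ofLp (u : EuclideanSpace ℝ (Fin (m + 1))) 0 = 0 ∧
      WithLp.ofLp (u' : EuclideanSpace ℝ (Fin (m + 1))) 0 = 0) := by
  have hc : ∀ i, WithLp.ofLp (gMap u : EuclideanSpace ℝ (Fin (m + 1))) i =
      WithLp.ofLp (gMap u' : EuclideanSpace ℝ (Fin (m + 1))) i := fun i => by rw [h]
  have h0 := hc 0
  simp only [ofLp_gMap, Pi.single_eq_same] at h0
  have h2 : WithLp.ofLp (u : EuclideanSpace ℝ (Fin (m + 1))) 0 ^ 2 =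
      WithLp.ofLp (u' : EuclideanSpace ℝ (Fin (m + 1))) 0 ^ 2 := by nlinarith [h0]
  have haa : WithLp.ofLp (u : EuclideanSpace ℝ (Fin (m + 1))) 0 =
      WithLp.ofLp (u' : EuclideanSpace ℝ (Fin (m + 1))) 0 := by
    have h3 := (sq_eq_sq_iff_abs_eq_abs _ _).mp h2
    rw [abs_of_nonpos hu, abs_of_nonpos hu'] at h3
    linarith
  by_cases h00 : WithLp.ofLp (u : EuclideanSpace ℝ (Fin (m + 1))) 0 = 0
  · exact Or.inr ⟨h00, haa ▸ h00⟩
  · refine Or.inl (sphere_ext fun i => ?_)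
    have hi := hc i
    simp only [ofLp_gMap] at hi
    rw [haa, sub_right_inj] at hi
    exact mul_left_cancel₀ (mul_ne_zero two_ne_zero (haa ▸ h00)) hi

/-- **`G` maps the closed hemisphere `u₀ ≤ 0` onto `Sᵐ`** (explicit preimage: for `z ≠ e₀`,
`u = (-s, z'/(2s))` with `s = √((1 - z₀)/2)`; for `z = e₀` any point of the equator, `m ≥ 1`).
[folklore] -/
theorem exists_gMap_eq [NeZero m] (z : sphere (0 : EuclideanSpace ℝ (Fin (m + 1))) 1) :
    ∃ u : sphere (0 : EuclideanSpace ℝ (Fin (m + 1))) 1,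
      WithLp.ofLp (u : EuclideanSpace ℝ (Fin (m + 1))) 0 ≤ 0 ∧ gMap u = z := by
  set z0 := WithLp.ofLp (z : EuclideanSpace ℝ (Fin (m + 1))) 0 with hz0
  have hz0le : z0 ≤ 1 := by nlinarith [sq_coord_le_one z 0]
  by_cases h1 : z0 = 1
  · -- `z = e₀`: take the equator point `e_m`
    have hz : z = pole m := by
      have hsum := sum_sq_ofLp_sphere z
      rw [Fin.sum_univ_succ, ← hz0, h1, one_pow, add_eq_left] at hsum
      have hall := (Finset.sum_eq_zero_iff_of_nonneg fun j _ => sq_nonneg _).mp hsum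
      refine sphere_ext fun i => ?_
      refine Fin.cases ?_ (fun j => ?_) i
      · rw [← hz0, h1, ofLp_pole, Pi.single_eq_same]
      · rw [ofLp_pole, Pi.single_eq_of_ne (Fin.succ_ne_zero j)]
        exact pow_eq_zero_iff two_ne_zero |>.mp (hall j (Finset.mem_univ j))
    refine ⟨lastPt m, ?_, ?_⟩
    · rw [ofLp_lastPt, Pi.single_eq_of_ne (Fin.last_pos'.ne : (0 : Fin (m + 1)) ≠ Fin.last m)]
    · rw [hz, gMap_eq_pole_of]
      rw [ofLp_lastPt, Pi.single_eq_of_ne (Fin.last_pos'.ne : (0 : Fin (m + 1)) ≠ Fin.last m)]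
  · have hlt : z0 < 1 := lt_of_le_of_ne hz0le h1
    set s := √((1 - z0) / 2) with hs
    have hs0 : 0 < s := Real.sqrt_pos.mpr (by linarith)
    have hss : s ^ 2 = (1 - z0) / 2 := Real.sq_sqrt (by linarith)
    let v : Fin (m + 1) → ℝ := fun i => if i = 0 then -s else
      WithLp.ofLp (z : EuclideanSpace ℝ (Fin (m + 1))) i / (2 * s)
    have hv : ∑ i, v i ^ 2 = 1 := by
      have hsum := sum_sq_ofLp_sphere z
      rw [Fin.sum_univ_succ] at hsum ⊢
      simp only [v, if_true, Fin.succ_ne_zero, if_false, neg_sq, div_pow]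
      rw [← Finset.sum_div]
      have hrest : ∑ j : Fin m, WithLp.ofLp (z : EuclideanSpace ℝ (Fin (m + 1))) j.succ ^ 2 = 1 - z0 ^ 2 := by
        rw [← hz0] at hsum; linarith
      rw [hrest, hss]
      field_simp
      nlinarith [hss]
    refine ⟨mkS v hv, ?_, sphere_ext fun i => ?_⟩
    · change v 0 ≤ 0
      simp only [v, if_true]
      linarith
    · rw [ofLp_gMap, ofLp_mkS]
      refine Fin.cases ?_ (fun j => ?_) i
      · simp only [v, if_true, Pi.single_eq_same]
        rw [← hz0]
        nlinarith [hss]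
      · simp only [v, if_true, Fin.succ_ne_zero, if_false, Pi.single_eq_of_ne (Fin.succ_ne_zero j)]
        field_simp
        ring

end Coordinates

/-! ### 2. The stereographic collapse `pc : (Iᵐ, ∂Iᵐ) → (Sᵐ, e_m)` -/

section Collapse

variable {m : ℕ}

/-- Centred cube coordinates `y = 2x - 1 ∈ [-1, 1]ᵐ`: the tree's `CubeHEP.cubeToBall`
(`Literature/AlgebraicTopology/Homotopy/CubeHomotopyExtension.lean`), abbreviated. [folklore] -/
abbrev ctr (x : Fin m → I) : Fin m → ℝ := CubeHEP.cubeToBall x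

/-- `ctr x j = 2 xⱼ - 1`. [folklore] -/
theorem ctr_apply (x : Fin m → I) (j : Fin m) : ctr x j = 2 * (x j : ℝ) - 1 := rfl

/-- The sup norm `r = ‖y‖∞ ≤ 1` (the tree's `CubeHEP.cubeToBall_mem_closedBall`). [folklore] -/
theorem norm_ctr_le_one (x : Fin m → I) : ‖ctr x‖ ≤ 1 :=
  mem_closedBall_zero_iff.1 (CubeHEP.cubeToBall_mem_closedBall x)

/-- `y = 0` iff `‖y‖∞ = 0`; in particular `‖y‖∞ = 0` forces `∑ yⱼ² = 0`. [folklore] -/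
theorem sum_ctr_sq_eq_zero_iff (x : Fin m → I) : ∑ j, ctr x j ^ 2 = 0 ↔ ctr x = 0 := by
  rw [Finset.sum_eq_zero_iff_of_nonneg fun _ _ => sq_nonneg _]
  simp only [Finset.mem_univ, forall_const, pow_eq_zero_iff two_ne_zero]
  exact ⟨fun h => funext h, fun h j => congrFun h j⟩

/-- The complement `q = 1 - ‖y‖∞ ≥ 0` of the sup norm. [folklore] -/
def cq (x : Fin m → I) : ℝ := 1 - ‖ctr x‖

/-- `0 ≤ q`. [folklore] -/
theorem cq_nonneg (x : Fin m → I) : 0 ≤ cq x := by unfold cq; linarith [norm_ctr_le_one x]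

/-- `q = 0` iff `x ∈ ∂Iᵐ`. [folklore] -/
theorem cq_eq_zero_iff (x : Fin m → I) : cq x = 0 ↔ x ∈ Cube.boundary (Fin m) := by
  rw [CubeHEP.mem_boundary_iff_norm_cubeToBall, cq, sub_eq_zero, eq_comm]

/-- `∑ yⱼ²`, the squared Euclidean norm of the centred coordinates. [folklore] -/
def cL (x : Fin m → I) : ℝ := ∑ j, ctr x j ^ 2

/-- `0 ≤ L`. [folklore] -/
theorem cL_nonneg (x : Fin m → I) : 0 ≤ cL x := Finset.sum_nonneg fun _ _ => sq_nonneg _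

/-- The denominator `D = L + q²` of the stereographic collapse. [folklore] -/
def cD (x : Fin m → I) : ℝ := cL x + cq x ^ 2

/-- **`D > 0`**: `L = 0` forces `y = 0`, `‖y‖∞ = 0`, `q = 1`. [folklore] -/
theorem cD_pos (x : Fin m → I) : 0 < cD x := by
  unfold cD
  rcases (cL_nonneg x).eq_or_lt with h | h
  · have hy : ctr x = 0 := (sum_ctr_sq_eq_zero_iff x).mp h.symm
    have hq : cq x = 1 := by rw [cq, hy, norm_zero, sub_zero]
    rw [← h, hq]
    norm_num
  · nlinarith [sq_nonneg (cq x)]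

/-- `ctr`, `cq`, `cL`, `cD` are continuous. [folklore] -/
theorem continuous_cq : Continuous (cq : (Fin m → I) → ℝ) :=
  continuous_const.sub (continuous_norm.comp CubeHEP.continuous_cubeToBall)

/-- `cL` is continuous. [folklore] -/
theorem continuous_cL : Continuous (cL : (Fin m → I) → ℝ) := by
  unfold cL
  exact continuous_finsetSum _ fun j _ => ((continuous_apply j).comp CubeHEP.continuous_cubeToBall).pow 2

/-- `cD` is continuous. [folklore] -/
theorem continuous_cD : Continuous (cD : (Fin m → I) → ℝ) :=
  continuous_cL.add (continuous_cq.pow 2)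

/-- The coordinate vector of the **stereographic collapse**: with `v = y/q`,
`pc x = (2v, ‖v‖² - 1)/(‖v‖² + 1) = (2 q y, L - q²)/(L + q²)` (inverse stereographic projection
from `e_m` of the blown-up cube). [folklore] -/
def pcVec (x : Fin m → I) : Fin (m + 1) → ℝ :=
  Fin.snoc (fun j => 2 * cq x * ctr x j / cD x) ((cL x - cq x ^ 2) / cD x)

/-- `pcVec x` on the first `m` coordinates. [folklore] -/
@[simp] theorem pcVec_castSucc (x : Fin m → I) (j : Fin m) :
    pcVec x j.castSucc = 2 * cq x * ctr x j / cD x := by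
  simp [pcVec]

/-- `pcVec x` on the last coordinate. [folklore] -/
@[simp] theorem pcVec_last (x : Fin m → I) : pcVec x (Fin.last m) = (cL x - cq x ^ 2) / cD x := by
  simp [pcVec]

/-- `pcVec x` is a unit vector: `4q²L + (L - q²)² = (L + q²)²`. [folklore] -/
theorem sum_pcVec_sq (x : Fin m → I) : ∑ i, pcVec x i ^ 2 = 1 := by
  have hD := cD_pos x
  rw [Fin.sum_univ_castSucc]
  simp only [pcVec_castSucc, pcVec_last, div_pow]
  rw [← Finset.sum_div]
  have h4 : ∑ j, (2 * cq x * ctr x j) ^ 2 = 4 * cq x ^ 2 * cL x := by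
    rw [cL, Finset.mul_sum]
    exact Finset.sum_congr rfl fun j _ => by ring
  rw [h4, ← add_div, div_eq_one_iff_eq (pow_ne_zero 2 hD.ne')]
  unfold cD
  ring

/-- `pcVec` is continuous (no division by zero occurs). [folklore] -/
theorem continuous_pcVec : Continuous (pcVec : (Fin m → I) → Fin (m + 1) → ℝ) := by
  refine continuous_pi fun i => ?_
  refine Fin.lastCases ?_ (fun j => ?_) i
  · simp only [pcVec_last]
    exact (continuous_cL.sub (continuous_cq.pow 2)).div continuous_cD fun x => (cD_pos x).ne'
  · simp only [pcVec_castSucc]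
    exact ((continuous_const.mul continuous_cq).mul ((continuous_apply j).comp CubeHEP.continuous_cubeToBall)).div
      continuous_cD fun x => (cD_pos x).ne'

/-- `pcVec x ⬝ pcVec x = 1`. [folklore] -/
theorem pcVec_dotProduct_self (x : Fin m → I) : pcVec x ⬝ᵥ pcVec x = 1 := by
  have h := sum_pcVec_sq x
  simpa only [dotProduct, sq] using h

/-- **The stereographic collapse** `pc : Iᵐ → Sᵐ`. [folklore] -/
def pc : C((Fin m → I), sphere (0 : EuclideanSpace ℝ (Fin (m + 1))) 1) where
  toFun x := mkS (pcVec x) (sum_pcVec_sq x)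
  continuous_toFun := Continuous.subtype_mk ((PiLp.continuous_toLp 2 _).comp continuous_pcVec) _

/-- Coordinates of `pc x`. [folklore] -/
@[simp] theorem ofLp_pc (x : Fin m → I) :
    WithLp.ofLp (pc x : EuclideanSpace ℝ (Fin (m + 1))) = pcVec x := rfl

/-- **`pc(∂Iᵐ) = e_m`.** [folklore] -/
theorem pc_eq_lastPt_of_mem {x : Fin m → I} (hx : x ∈ Cube.boundary (Fin m)) : pc x = lastPt m := by
  have hq : cq x = 0 := (cq_eq_zero_iff x).mpr hx
  have hD := cD_pos x
  refine sphere_ext fun i => ?_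
  rw [ofLp_pc, ofLp_lastPt]
  refine Fin.lastCases ?_ (fun j => ?_) i
  · rw [pcVec_last, Pi.single_eq_same]
    unfold cD at hD ⊢
    rw [hq] at hD ⊢
    have hL : cL x ≠ 0 := by nlinarith [hD]
    rw [zero_pow two_ne_zero, sub_zero, add_zero, div_self hL]
  · rw [pcVec_castSucc, Pi.single_eq_of_ne (Fin.castSucc_lt_last j).ne, hq]
    simp

/-- **Conversely `pc x = e_m` only on `∂Iᵐ`** (the last coordinate is `1` iff `q = 0`).
[folklore] -/
theorem mem_boundary_of_pc_eq_lastPt {x : Fin m → I} (hx : pc x = lastPt m) : x ∈ Cube.boundary (Fin m) := by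
  rw [← cq_eq_zero_iff]
  have h := congrArg (fun u : sphere (0 : EuclideanSpace ℝ (Fin (m + 1))) 1 =>
    WithLp.ofLp (u : EuclideanSpace ℝ (Fin (m + 1))) (Fin.last m)) hx
  simp only [ofLp_pc, pcVec_last, ofLp_lastPt, Pi.single_eq_same] at h
  have hD := cD_pos x
  rw [div_eq_one_iff_eq hD.ne', cD] at h
  nlinarith [h]

/-- The last coordinate of `pc x` is `< 1` off the boundary. [folklore] -/
theorem pcVec_last_lt_one_of_not_mem {x : Fin m → I} (hx : x ∉ Cube.boundary (Fin m)) :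
    pcVec x (Fin.last m) < 1 := by
  have hq : cq x ≠ 0 := fun h => hx ((cq_eq_zero_iff x).mp h)
  have hD := cD_pos x
  rw [pcVec_last, div_lt_one hD, cD]
  have := sq_pos_of_ne_zero hq
  linarith

/-- **Equivariance**: reflecting the cube coordinates in `S` changes the sign of the corresponding
coordinates of `pc` (`r`, `q`, `L`, `D` are unchanged). [folklore] -/
theorem pc_flip (S : Finset (Fin m)) (x : Fin m → I) :
    pc (fun j => if j ∈ S then σ (x j) else x j) = negCoords (S.map Fin.castSuccEmb) (pc x) := by
  set x' : Fin m → I := fun j => if j ∈ S then σ (x j) else x j with hx'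
  have hc : ∀ j, ctr x' j = if j ∈ S then -ctr x j else ctr x j := fun j => by
    simp only [ctr_apply, hx']
    split_ifs with h
    · rw [unitInterval.coe_symm_eq]; ring
    · rfl
  have hn : ‖ctr x'‖ = ‖ctr x‖ := by
    simp only [Pi.norm_def]
    congr 1
    apply Finset.sup_congr rfl
    intro j _
    rw [hc]
    split_ifs <;> simp
  have hq : cq x' = cq x := by rw [cq, cq, hn]
  have hL : cL x' = cL x := by
    unfold cL
    exact Finset.sum_congr rfl fun j _ => by rw [hc]; split_ifs <;> ring
  have hD : cD x' = cD x := by rw [cD, cD, hq, hL]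
  refine sphere_ext fun i => ?_
  rw [ofLp_pc, ofLp_negCoords, ofLp_pc]
  refine Fin.lastCases ?_ (fun j => ?_) i
  · have hnot : Fin.last m ∉ S.map Fin.castSuccEmb := by
      simp only [Finset.mem_map, Fin.castSuccEmb_apply, not_exists, not_and]
      exact fun j _ => (Fin.castSucc_lt_last j).ne
    rw [if_neg hnot, pcVec_last, pcVec_last, hq, hL, hD]
  · have hiff : Fin.castSucc j ∈ S.map Fin.castSuccEmb ↔ j ∈ S := by
      simp [Finset.mem_map, Fin.castSucc_inj]
    simp only [pcVec_castSucc, hq, hD, hc j, hiff]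
    split_ifs <;> ring

/-- **`pc` is injective off the boundary**: `pc x = pc x'` forces `x = x'` or `x, x' ∈ ∂Iᵐ`.
*Proof.* With `q, q' > 0`: `q²/D = q'²/D'` and `2qy/D = 2q'y'/D'` give `y = (q/q') y'`, and then
`‖y‖∞ = (q/q')‖y'‖∞` with `q = 1 - ‖y‖∞` forces `‖y‖∞ = ‖y'‖∞`, `y = y'`. [folklore] -/
theorem pc_eq_pc_imp {x x' : Fin m → I} (h : pc x = pc x') :
    x = x' ∨ (x ∈ Cube.boundary (Fin m) ∧ x' ∈ Cube.boundary (Fin m)) := by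
  have hD := cD_pos x
  have hD' := cD_pos x'
  have hc : ∀ i, pcVec x i = pcVec x' i := fun i =>
    congrFun (congrArg (fun u : sphere (0 : EuclideanSpace ℝ (Fin (m + 1))) 1 =>
      WithLp.ofLp (u : EuclideanSpace ℝ (Fin (m + 1)))) h) i
  -- last coordinate: `q² / D = q'² / D'`
  have hlast := hc (Fin.last m)
  simp only [pcVec_last] at hlast
  have hqq : cq x ^ 2 / cD x = cq x' ^ 2 / cD x' := by
    have h1 : (cL x - cq x ^ 2) / cD x = 1 - 2 * (cq x ^ 2 / cD x) := by
      field_simp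
      unfold cD
      ring
    have h2 : (cL x' - cq x' ^ 2) / cD x' = 1 - 2 * (cq x' ^ 2 / cD x') := by
      field_simp
      unfold cD
      ring
    rw [h1, h2] at hlast
    linarith
  by_cases hq0 : cq x = 0
  · -- then also `q' = 0`: both on the boundary
    have hq0' : cq x' = 0 := by
      rw [hq0] at hqq
      simp only [ne_eq, OfNat.ofNat_ne_zero, not_false_eq_true, zero_pow, zero_div] at hqq
      exact pow_eq_zero_iff two_ne_zero |>.mp ((div_eq_zero_iff.mp hqq.symm).resolve_right hD'.ne')
    exact Or.inr ⟨(cq_eq_zero_iff x).mp hq0, (cq_eq_zero_iff x').mp hq0'⟩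
  · have hq0' : cq x' ≠ 0 := by
      intro h0
      rw [h0] at hqq
      simp only [ne_eq, OfNat.ofNat_ne_zero, not_false_eq_true, zero_pow, zero_div] at hqq
      exact hq0 (pow_eq_zero_iff two_ne_zero |>.mp ((div_eq_zero_iff.mp hqq).resolve_right hD.ne'))
    have hqpos : 0 < cq x := lt_of_le_of_ne (cq_nonneg x) (Ne.symm hq0)
    have hqpos' : 0 < cq x' := lt_of_le_of_ne (cq_nonneg x') (Ne.symm hq0')
    -- the ratio `κ = q / q'`, and `y = κ y'`
    set κ : ℝ := cq x / cq x' with hκ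
    have hκpos : 0 < κ := div_pos hqpos hqpos'
    have hDD : cD x = κ ^ 2 * cD x' := by
      rw [hκ, div_pow]
      field_simp
      field_simp at hqq
      linarith [hqq]
    have hy : ∀ j, ctr x j = κ * ctr x' j := fun j => by
      have hj := hc j.castSucc
      simp only [pcVec_castSucc] at hj
      rw [hDD] at hj
      have hκq : cq x = κ * cq x' := by rw [hκ]; field_simp
      rw [hκq] at hj
      field_simp at hj
      nlinarith [hj, hκpos, hqpos', hD']
    -- norms: `‖y‖ = κ ‖y'‖`, and `q = 1 - ‖y‖`
    have hn : ‖ctr x‖ = κ * ‖ctr x'‖ := by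
      have : ctr x = κ • ctr x' := funext fun j => by rw [Pi.smul_apply, smul_eq_mul, hy]
      rw [this, norm_smul, Real.norm_of_nonneg hκpos.le]
    have hκ1 : κ = 1 := by
      have h1 : cq x = κ * cq x' := by rw [hκ]; field_simp
      unfold cq at h1
      rw [hn] at h1
      nlinarith [h1, norm_nonneg (ctr x')]
    left
    funext j
    have := hy j
    rw [hκ1, one_mul, ctr_apply, ctr_apply] at this
    exact Subtype.ext (by linarith)

/-- **`pc` is onto**, with control of the sign of the first cube coordinate: every `u ∈ Sᵐ` is
`pc x` for some `x` with, moreover, `x₀ ≤ ½` whenever `u₀ ≤ 0` (explicit preimage through the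
stereographic projection `v = u'/(1 - u_m)` and `y = v/(1 + ‖v‖∞)`; for `u = e_m` a boundary
point). [folklore] -/
theorem exists_pc_eq [NeZero m] (u : sphere (0 : EuclideanSpace ℝ (Fin (m + 1))) 1) :
    ∃ x : Fin m → I, pc x = u ∧
      (WithLp.ofLp (u : EuclideanSpace ℝ (Fin (m + 1))) (Fin.castSucc 0) ≤ 0 → (x 0 : ℝ) ≤ 1 / 2) := by
  set a := WithLp.ofLp (u : EuclideanSpace ℝ (Fin (m + 1))) (Fin.last m) with ha
  have hale : a ≤ 1 := by nlinarith [sq_coord_le_one u (Fin.last m)]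
  by_cases h1 : a = 1
  · -- `u = e_m`: any boundary point with `x₀ = 0` will do
    have hu : u = lastPt m := by
      have hsum := sum_sq_ofLp_sphere u
      rw [Fin.sum_univ_castSucc, ← ha, h1, one_pow, add_eq_right] at hsum
      have hall := (Finset.sum_eq_zero_iff_of_nonneg fun j _ => sq_nonneg _).mp hsum
      refine sphere_ext fun i => ?_
      refine Fin.lastCases ?_ (fun j => ?_) i
      · rw [← ha, h1, ofLp_lastPt, Pi.single_eq_same]
      · rw [ofLp_lastPt, Pi.single_eq_of_ne (Fin.castSucc_lt_last j).ne]
        exact pow_eq_zero_iff two_ne_zero |>.mp (hall j (Finset.mem_univ j))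
    refine ⟨fun _ => 0, ?_, fun _ => by norm_num⟩
    rw [hu]
    exact pc_eq_lastPt_of_mem ⟨0, Or.inl rfl⟩
  · have hlt : a < 1 := lt_of_le_of_ne hale h1
    -- stereographic coordinates `v = u' / (1 - a)` and `y = v / (1 + ‖v‖)`
    let v : Fin m → ℝ := fun j => WithLp.ofLp (u : EuclideanSpace ℝ (Fin (m + 1))) j.castSucc / (1 - a)
    set ν : ℝ := ‖v‖ with hν
    have hν0 : 0 ≤ ν := norm_nonneg v
    let y : Fin m → ℝ := fun j => v j / (1 + ν)
    have hyabs : ∀ j, |y j| < 1 := fun j => by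
      change |v j / (1 + ν)| < 1
      rw [abs_div, abs_of_pos (show (0 : ℝ) < 1 + ν by linarith), div_lt_one (show (0 : ℝ) < 1 + ν by linarith)]
      have := norm_le_pi_norm v j
      rw [Real.norm_eq_abs] at this
      linarith
    let x : Fin m → I := fun j => ⟨(y j + 1) / 2, by
      constructor <;> nlinarith [abs_lt.mp (hyabs j)]⟩
    have hctr : ctr x = y := funext fun j => by change 2 * ((y j + 1) / 2) - 1 = y j; ring
    have hnorm : ‖ctr x‖ = ν / (1 + ν) := by
      rw [hctr]
      have : y = (1 + ν)⁻¹ • v := funext fun j => by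
        change v j / (1 + ν) = (1 + ν)⁻¹ * v j
        rw [div_eq_inv_mul]
      rw [this, norm_smul, Real.norm_of_nonneg (inv_nonneg.mpr (by linarith)), ← hν,
        inv_mul_eq_div]
    have hq : cq x = 1 / (1 + ν) := by
      rw [cq, hnorm]
      field_simp
      ring
    -- `∑ u'ⱼ² = 1 - a²` and `‖v‖₂² = (1 + a)/(1 - a)`
    have hsum' : ∑ j : Fin m, WithLp.ofLp (u : EuclideanSpace ℝ (Fin (m + 1))) j.castSucc ^ 2 = 1 - a ^ 2 := by
      have hsum := sum_sq_ofLp_sphere u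
      rw [Fin.sum_univ_castSucc, ← ha] at hsum
      linarith
    have hL : cL x = (1 + a) / ((1 - a) * (1 + ν) ^ 2) := by
      unfold cL
      rw [hctr]
      have : ∀ j, y j ^ 2 = WithLp.ofLp (u : EuclideanSpace ℝ (Fin (m + 1))) j.castSucc ^ 2 /
          ((1 - a) ^ 2 * (1 + ν) ^ 2) := fun j => by
        change (WithLp.ofLp (u : EuclideanSpace ℝ (Fin (m + 1))) j.castSucc / (1 - a) / (1 + ν)) ^ 2 = _
        rw [div_div, div_pow, mul_pow]
      simp_rw [this]
      rw [← Finset.sum_div, hsum']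
      have h1a : (1 - a) ≠ 0 := by linarith
      field_simp
      ring
    have hD : cD x = 2 / ((1 - a) * (1 + ν) ^ 2) := by
      rw [cD, hL, hq]
      have h1a : (1 - a) ≠ 0 := by linarith
      field_simp
      ring
    refine ⟨x, sphere_ext fun i => ?_, fun h0 => ?_⟩
    · rw [ofLp_pc]
      refine Fin.lastCases ?_ (fun j => ?_) i
      · rw [pcVec_last, hL, hq, hD, ← ha]
        have h1a : (1 - a) ≠ 0 := by linarith
        have h1n : (1 + ν) ≠ 0 := by linarith
        field_simp
        ring
      · rw [pcVec_castSucc, hq, hD, hctr]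
        change 2 * (1 / (1 + ν)) * (WithLp.ofLp (u : EuclideanSpace ℝ (Fin (m + 1))) j.castSucc /
          (1 - a) / (1 + ν)) / (2 / ((1 - a) * (1 + ν) ^ 2)) = _
        have h1a : (1 - a) ≠ 0 := by linarith
        have h1n : (1 + ν) ≠ 0 := by linarith
        field_simp
    · change ((y 0 + 1) / 2 : ℝ) ≤ 1 / 2
      have hy0 : y 0 ≤ 0 := by
        change WithLp.ofLp (u : EuclideanSpace ℝ (Fin (m + 1))) (Fin.castSucc 0) / (1 - a) / (1 + ν) ≤ 0
        exact div_nonpos_of_nonpos_of_nonneg (div_nonpos_of_nonpos_of_nonneg h0 (by linarith))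
          (by linarith)
      linarith

end Collapse

/-! ### 3. The characteristic loop `T`, its projection `G ∘ pc = τ₊ ∗ τ₋`, and `[τ₋] = [τ₊]` -/

section Loops

variable {n : ℕ}

/-- A product of two reflections is special orthogonal. [folklore] -/
theorem reflMat_mul_reflMat_mem {ι : Type*} [Fintype ι] [DecidableEq ι] {a b : ι → ℝ}
    (ha : a ⬝ᵥ a ≠ 0) (hb : b ⬝ᵥ b ≠ 0) :
    reflMat a * reflMat b ∈ Matrix.specialOrthogonalGroup ι ℝ :=
  Matrix.mem_specialOrthogonalGroup_iff.mpr
    ⟨Submonoid.mul_mem _ (reflMat_mem_orthogonalGroup ha) (reflMat_mem_orthogonalGroup hb), by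
      rw [det_mul, det_reflMat ha, det_reflMat hb]; norm_num⟩

/-- `e_m ⬝ e_m = 1` (`m = n + 1`). [folklore] -/
theorem single_last_dotProduct_self :
    (Pi.single (Fin.last (n + 1)) 1 : Fin (n + 2) → ℝ) ⬝ᵥ Pi.single (Fin.last (n + 1)) 1 = 1 := by
  rw [single_dotProduct, one_mul, Pi.single_eq_same]

/-- `e_m ⬝ e₀ = 0`. [folklore] -/
theorem single_last_dotProduct_single_zero :
    (Pi.single (Fin.last (n + 1)) 1 : Fin (n + 2) → ℝ) ⬝ᵥ Pi.single 0 1 = 0 := by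
  rw [single_dotProduct, one_mul, Pi.single_eq_of_ne (ne_of_lt Fin.last_pos).symm]

/-- `pcVec = e_m` on `∂Iᵐ`. [folklore] -/
theorem pcVec_eq_single_of_mem {x : Fin (n + 1) → I} (hx : x ∈ Cube.boundary (Fin (n + 1))) :
    pcVec x = Pi.single (Fin.last (n + 1)) 1 :=
  congrArg (fun u : sphere (0 : EuclideanSpace ℝ (Fin (n + 2))) 1 =>
    WithLp.ofLp (u : EuclideanSpace ℝ (Fin (n + 2)))) (pc_eq_lastPt_of_mem hx)

/-- **Steenrod's characteristic loop** `T(x) = ρ_{pc x} ρ_{e_m} : (Iᵐ, ∂Iᵐ) → (SO(m + 1), 1)`,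
`m = n + 1` (Steenrod §23.3, `T_{m+1}` read on the cube through the collapse `pc`; based since
`pc(∂Iᵐ) = e_m`). [cite: Steenrod1951, §23.3] -/
def tLoop : Ω^ (Fin (n + 1)) (Matrix.specialOrthogonalGroup (Fin (n + 2)) ℝ) 1 :=
  ⟨⟨fun x => ⟨reflMat (pcVec x) * reflMat (Pi.single (Fin.last (n + 1)) 1),
      reflMat_mul_reflMat_mem (by rw [pcVec_dotProduct_self]; exact one_ne_zero)
        (by rw [single_last_dotProduct_self]; exact one_ne_zero)⟩,
    Continuous.subtype_mk ((continuous_reflMat continuous_pcVec fun x => by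
      rw [pcVec_dotProduct_self]; exact one_ne_zero).mul continuous_const) _⟩,
   fun x hx => by
    apply Subtype.ext
    change reflMat (pcVec x) * reflMat (Pi.single (Fin.last (n + 1)) 1) = 1
    rw [pcVec_eq_single_of_mem hx,
      reflMat_mul_self (by rw [single_last_dotProduct_self]; exact one_ne_zero)]⟩

/-- The matrix of `T(x)`. [folklore] -/
theorem coe_tLoop (x : Fin (n + 1) → I) :
    (tLoop x).1 = reflMat (pcVec x) * reflMat (Pi.single (Fin.last (n + 1)) 1) := rfl

/-- `G(e_m) = e₀`. [folklore] -/
theorem gMap_lastPt : gMap (lastPt (n + 1)) = pole (n + 1) :=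
  gMap_eq_pole_of (by rw [ofLp_lastPt, Pi.single_eq_of_ne (ne_of_lt Fin.last_pos)])

/-- The based loop `G ∘ pc : (Iᵐ, ∂Iᵐ) → (Sᵐ, e₀)` (`= p' ∘ T`, Steenrod §23.4).
[cite: Steenrod1951, §23.4] -/
def gpLoop : Ω^ (Fin (n + 1)) (sphere (0 : EuclideanSpace ℝ (Fin (n + 2))) 1) (pole (n + 1)) :=
  ⟨gMap.comp pc, fun x hx => by
    change gMap (pc x) = pole (n + 1)
    rw [pc_eq_lastPt_of_mem hx]
    exact gMap_lastPt⟩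

/-- `gpLoop` pointwise. [folklore] -/
@[simp] theorem gpLoop_apply (x : Fin (n + 1) → I) : gpLoop x = gMap (pc x) := rfl

/-- **`p' ∘ T = G ∘ pc`**: `ρ_{pc x} ρ_{e_m} e₀ = ρ_{pc x} e₀` as `e_m ⊥ e₀`. [cite: Steenrod1951, §23.4] -/
theorem projLoop_tLoop : projLoop (tLoop (n := n)) = gpLoop := by
  refine GenLoop.ext _ _ fun x => sphere_ext fun i => ?_
  change ((reflMat (pcVec x) * reflMat (Pi.single (Fin.last (n + 1)) 1)) *ᵥ
    WithLp.ofLp (pole (n + 1) : EuclideanSpace ℝ (Fin (n + 2)))) i =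
    (reflMat (pcVec x) *ᵥ WithLp.ofLp (pole (n + 1) : EuclideanSpace ℝ (Fin (n + 2)))) i
  rw [ofLp_pole, ← mulVec_mulVec,
    reflMat_mulVec_of_dotProduct_eq_zero single_last_dotProduct_single_zero]

/-- Squeezing the first coordinate into the lower half: `t ↦ (t₀/2, t₁, …)`. [folklore] -/
def sqL (t : Fin (n + 1) → I) : Fin (n + 1) → I := Function.update t 0 (halfL (t 0))

/-- Squeezing the first coordinate into the upper half: `t ↦ ((1 + t₀)/2, t₁, …)`. [folklore] -/
def sqR (t : Fin (n + 1) → I) : Fin (n + 1) → I := Function.update t 0 (halfR (t 0))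

/-- `sqL` is continuous. [folklore] -/
theorem continuous_sqL : Continuous (sqL (n := n)) :=
  continuous_id.update 0 (halfL.continuous.comp (continuous_apply 0))

/-- `sqR` is continuous. [folklore] -/
theorem continuous_sqR : Continuous (sqR (n := n)) :=
  continuous_id.update 0 (halfR.continuous.comp (continuous_apply 0))

/-- `sqL t` at `0`. [folklore] -/
@[simp] theorem sqL_zero (t : Fin (n + 1) → I) : sqL t 0 = halfL (t 0) := Function.update_self _ _ _

/-- `sqR t` at `0`. [folklore] -/
@[simp] theorem sqR_zero (t : Fin (n + 1) → I) : sqR t 0 = halfR (t 0) := Function.update_self _ _ _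

/-- `sqL t` at `succ j`. [folklore] -/
@[simp] theorem sqL_succ (t : Fin (n + 1) → I) (j : Fin n) : sqL t j.succ = t j.succ :=
  Function.update_of_ne (Fin.succ_ne_zero j) _ _

/-- `sqR t` at `succ j`. [folklore] -/
@[simp] theorem sqR_succ (t : Fin (n + 1) → I) (j : Fin n) : sqR t j.succ = t j.succ :=
  Function.update_of_ne (Fin.succ_ne_zero j) _ _

/-- The centred first coordinate of `sqL t` is `t₀ - 1 ≤ 0`. [folklore] -/
theorem ctr_sqL_zero (t : Fin (n + 1) → I) : ctr (sqL t) 0 = (t 0 : ℝ) - 1 := by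
  rw [ctr_apply, sqL_zero, coe_halfL]
  ring

/-- `sqL t ∈ ∂Iᵐ` forces `t ∈ ∂Iᵐ`. [folklore] -/
theorem mem_boundary_of_sqL_mem {t : Fin (n + 1) → I} (h : sqL t ∈ Cube.boundary (Fin (n + 1))) :
    t ∈ Cube.boundary (Fin (n + 1)) := by
  obtain ⟨j, hj⟩ := h
  refine ⟨j, ?_⟩
  by_cases hj0 : j = 0
  · subst hj0
    rw [sqL_zero] at hj
    have h1 := (t 0).2.2
    rcases hj with h | h
    · left
      apply Subtype.ext
      have := congrArg Subtype.val h
      simp only [coe_halfL, Set.Icc.coe_zero] at this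
      change (t 0 : ℝ) = 0
      linarith [this]
    · exfalso
      have := congrArg Subtype.val h
      simp only [coe_halfL, Set.Icc.coe_one] at this
      linarith
  · obtain ⟨j', rfl⟩ := Fin.exists_succ_eq.mpr hj0
    rwa [sqL_succ] at hj

/-- `sqL` is injective. [folklore] -/
theorem sqL_injective : Function.Injective (sqL (n := n)) := fun t t' h => by
  funext j
  by_cases hj0 : j = 0
  · subst hj0
    have h0 := congrArg (fun x : Fin (n + 1) → I => (x 0 : ℝ)) h
    simp only [sqL_zero, coe_halfL] at h0
    exact Subtype.ext (by linarith)
  · obtain ⟨j', rfl⟩ := Fin.exists_succ_eq.mpr hj0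
    have h1 := congrFun h j'.succ
    rwa [sqL_succ, sqL_succ] at h1

/-- The first coordinate of `pc (sqL t)` is `≤ 0`. [folklore] -/
theorem pcVec_sqL_zero_nonpos (t : Fin (n + 1) → I) : pcVec (sqL t) (Fin.castSucc 0) ≤ 0 := by
  rw [pcVec_castSucc, ctr_sqL_zero]
  refine div_nonpos_of_nonpos_of_nonneg ?_ (cD_pos _).le
  have := cq_nonneg (sqL t)
  have := (t 0).2.2
  nlinarith

/-- If the first coordinate of `pc (sqL t)` vanishes then `t ∈ ∂Iᵐ` (`q = 0` or `t₀ = 1`).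
[folklore] -/
theorem mem_boundary_of_pcVec_sqL_zero {t : Fin (n + 1) → I} (h : pcVec (sqL t) (Fin.castSucc 0) = 0) :
    t ∈ Cube.boundary (Fin (n + 1)) := by
  rw [pcVec_castSucc, ctr_sqL_zero, div_eq_zero_iff] at h
  rcases h with h | h
  · rcases mul_eq_zero.mp h with h | h
    · rcases mul_eq_zero.mp h with h | h
      · norm_num at h
      · exact mem_boundary_of_sqL_mem ((cq_eq_zero_iff _).mp h)
    · exact ⟨0, Or.inr (Subtype.ext (by change (t 0 : ℝ) = 1; linarith))⟩
  · exact absurd h (cD_pos _).ne'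

/-- `x ↦ G (pc x)` is `e₀` where the first coordinate of `pc x` vanishes. [folklore] -/
theorem gMap_pc_eq_pole_of {x : Fin (n + 1) → I} (h : pcVec x (Fin.castSucc 0) = 0) :
    gMap (pc x) = pole (n + 1) :=
  gMap_eq_pole_of (by rw [← Fin.castSucc_zero]; exact h)

/-- **The lower half `τ₊`** of `G ∘ pc`: `τ₊(t) = G(pc(t₀/2, t₁, …))`, a based loop at `e₀`
(the wall `t₀ = 1` goes to the equator `u₀ = 0`, which `G` collapses to `e₀`). [folklore] -/
def tauP : Ω^ (Fin (n + 1)) (sphere (0 : EuclideanSpace ℝ (Fin (n + 2))) 1) (pole (n + 1)) :=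
  ⟨⟨fun t => gpLoop (sqL t), gpLoop.1.continuous.comp continuous_sqL⟩, fun t ht => by
    obtain ⟨j, hj⟩ := ht
    change gMap (pc (sqL t)) = pole (n + 1)
    by_cases hj0 : j = 0
    · subst hj0
      rcases hj with h | h
      · rw [pc_eq_lastPt_of_mem ⟨0, Or.inl ?_⟩, gMap_lastPt]
        apply Subtype.ext
        rw [sqL_zero, coe_halfL, h]
        simp
      · apply gMap_pc_eq_pole_of
        rw [pcVec_castSucc, ctr_sqL_zero, h]
        simp
    · obtain ⟨j', rfl⟩ := Fin.exists_succ_eq.mpr hj0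
      rw [pc_eq_lastPt_of_mem ⟨j'.succ, by rwa [sqL_succ]⟩, gMap_lastPt]⟩

/-- **The upper half `τ₋`** of `G ∘ pc`: `τ₋(t) = G(pc((1 + t₀)/2, t₁, …))`. [folklore] -/
def tauM : Ω^ (Fin (n + 1)) (sphere (0 : EuclideanSpace ℝ (Fin (n + 2))) 1) (pole (n + 1)) :=
  ⟨⟨fun t => gpLoop (sqR t), gpLoop.1.continuous.comp continuous_sqR⟩, fun t ht => by
    obtain ⟨j, hj⟩ := ht
    change gMap (pc (sqR t)) = pole (n + 1)
    by_cases hj0 : j = 0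
    · subst hj0
      rcases hj with h | h
      · apply gMap_pc_eq_pole_of
        rw [pcVec_castSucc, ctr_apply, sqR_zero, coe_halfR, h]
        simp
      · rw [pc_eq_lastPt_of_mem ⟨0, Or.inr ?_⟩, gMap_lastPt]
        apply Subtype.ext
        rw [sqR_zero, coe_halfR, h]
        norm_num
    · obtain ⟨j', rfl⟩ := Fin.exists_succ_eq.mpr hj0
      rw [pc_eq_lastPt_of_mem ⟨j'.succ, by rwa [sqR_succ]⟩, gMap_lastPt]⟩

/-- `tauP` pointwise. [folklore] -/
@[simp] theorem tauP_apply (t : Fin (n + 1) → I) : tauP t = gMap (pc (sqL t)) := rfl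

/-- `tauM` pointwise. [folklore] -/
@[simp] theorem tauM_apply (t : Fin (n + 1) → I) : tauM t = gMap (pc (sqR t)) := rfl

/-- `sqL (2t₀, …) = t` for `t₀ ≤ ½`. [folklore] -/
theorem sqL_lowerArg_of_le {t : Fin (n + 1) → I} (h : (t 0 : ℝ) ≤ 1 / 2) : sqL (lowerArg t) = t := by
  rw [sqL, lowerArg, Function.update_idem, Function.update_eq_self_iff, Function.update_self]
  apply Subtype.ext
  rw [coe_halfL, Set.projIcc_of_mem _ ⟨by linarith [(t 0).2.1], by linarith⟩]
  ring

/-- `sqR (2t₀ - 1, …) = t` for `½ < t₀`. [folklore] -/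
theorem sqR_upperArg_of_lt {t : Fin (n + 1) → I} (h : 1 / 2 < (t 0 : ℝ)) : sqR (upperArg t) = t := by
  rw [sqR, upperArg, Function.update_idem, Function.update_eq_self_iff, Function.update_self]
  apply Subtype.ext
  rw [coe_halfR, Set.projIcc_of_mem _ ⟨by linarith, by linarith [(t 0).2.2]⟩]
  ring

/-- **`G ∘ pc = τ₊ ∗ τ₋`** (concatenation along `t₀`, Mathlib's `transAt 0`), on the nose.
[folklore] -/
theorem gpLoop_eq_transAt : (gpLoop (n := n)) = GenLoop.transAt 0 tauP tauM := by
  refine GenLoop.ext _ _ fun t => ?_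
  rw [transAt_zero_apply]
  split_ifs with h
  · rw [tauP_apply, sqL_lowerArg_of_le h, gpLoop_apply]
  · rw [tauM_apply, sqR_upperArg_of_lt (lt_of_not_ge h), gpLoop_apply]

/-- Reflection of the cube coordinates in `S`: `xⱼ ↦ 1 - xⱼ` for `j ∈ S`. [folklore] -/
def flipSet (S : Finset (Fin (n + 1))) (t : Fin (n + 1) → I) : Fin (n + 1) → I :=
  fun j => if j ∈ S then σ (t j) else t j

/-- `flipSet S` is continuous. [folklore] -/
theorem continuous_flipSet (S : Finset (Fin (n + 1))) : Continuous (flipSet S) := by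
  refine continuous_pi fun j => ?_
  unfold flipSet
  split_ifs
  · exact unitInterval.continuous_symm.comp (continuous_apply j)
  · exact continuous_apply j

/-- `flipSet S` preserves `∂Iᵐ`. [folklore] -/
theorem flipSet_mem_boundary (S : Finset (Fin (n + 1))) {t : Fin (n + 1) → I}
    (ht : t ∈ Cube.boundary (Fin (n + 1))) : flipSet S t ∈ Cube.boundary (Fin (n + 1)) := by
  obtain ⟨j, hj⟩ := ht
  refine ⟨j, ?_⟩
  unfold flipSet
  split_ifs
  · rcases hj with h | h
    · right; rw [h, unitInterval.symm_zero]
    · left; rw [h, unitInterval.symm_one]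
  · exact hj

/-- The loop `p ∘ flipSet S`. [folklore] -/
def flipLoop {X : Type*} [TopologicalSpace X] {x : X} (S : Finset (Fin (n + 1)))
    (p : Ω^ (Fin (n + 1)) X x) : Ω^ (Fin (n + 1)) X x :=
  ⟨⟨fun t => p (flipSet S t), p.1.continuous.comp (continuous_flipSet S)⟩, fun _ ht =>
    GenLoop.boundary p _ (flipSet_mem_boundary S ht)⟩

/-- `flipLoop S p` pointwise. [folklore] -/
@[simp] theorem flipLoop_apply {X : Type*} [TopologicalSpace X] {x : X} (S : Finset (Fin (n + 1)))
    (p : Ω^ (Fin (n + 1)) X x) (t : Fin (n + 1) → I) : flipLoop S p t = p (flipSet S t) := rfl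

/-- No reflection: `flipLoop ∅ p = p`. [folklore] -/
theorem flipLoop_empty {X : Type*} [TopologicalSpace X] {x : X} (p : Ω^ (Fin (n + 1)) X x) :
    flipLoop ∅ p = p :=
  GenLoop.ext _ _ fun t => by
    rw [flipLoop_apply]
    congr 1

/-- One more reflection: `flipLoop (insert i S) p` is `flipLoop S p` reversed along `i`.
[folklore] -/
theorem flipLoop_insert {X : Type*} [TopologicalSpace X] {x : X} {i : Fin (n + 1)}
    {S : Finset (Fin (n + 1))} (hi : i ∉ S) (p : Ω^ (Fin (n + 1)) X x) :
    flipLoop (insert i S) p = GenLoop.symmAt i (flipLoop S p) :=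
  GenLoop.ext _ _ fun t => by
    rw [flipLoop_apply]
    change p (flipSet (insert i S) t) = p (flipSet S fun j => if j = i then σ (t i) else t j)
    congr 1
    funext j
    simp only [flipSet, Finset.mem_insert]
    by_cases hji : j = i
    · subst hji
      simp [hi]
    · simp [hji]

/-- **Reflecting `k` cube coordinates multiplies the class by `(-1)ᵏ`** (Mathlib:
`⟦symmAt i p⟧ = ⟦p⟧⁻¹`, iterated). [folklore] -/
theorem cls_flipLoop {X : Type*} [TopologicalSpace X] {x : X} (S : Finset (Fin (n + 1)))
    (p : Ω^ (Fin (n + 1)) X x) : cls (flipLoop S p) = cls p ^ ((-1 : ℤ) ^ S.card) := by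
  induction S using Finset.induction_on with
  | empty => rw [flipLoop_empty, Finset.card_empty, pow_zero, zpow_one]
  | insert i S hi ih =>
    rw [flipLoop_insert hi, ← cls_inv, ih, Finset.card_insert_of_notMem hi, pow_succ, mul_neg_one,
      _root_.zpow_neg]

/-- The reflection in the coordinate `0` of the cube `Iᵐ`. [folklore] -/
theorem flipSet_zero_eq (t : Fin (n + 1) → I) :
    flipSet {0} t = fun j => if j = 0 then σ (t 0) else t j := by
  funext j
  simp only [flipSet, Finset.mem_singleton]
  by_cases hj : j = 0
  · subst hj; simp
  · simp [hj]

/-- **Equivariance of `pc` under the reflection in `x₀`**: `pc ∘ flip₀ = R₀ ∘ pc`.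
[folklore] -/
theorem pc_flipSet_zero (x : Fin (n + 1) → I) : pc (flipSet {0} x) = negCoords {0} (pc x) := by
  have h := pc_flip {0} x
  rw [Finset.map_singleton, Fin.castSuccEmb_apply, Fin.castSucc_zero] at h
  exact h

/-- **Equivariance of `pc` under reflections in the other cube coordinates.** [folklore] -/
theorem pc_flipSet (S : Finset (Fin (n + 1))) (x : Fin (n + 1) → I) :
    pc (flipSet S x) = negCoords (S.map Fin.castSuccEmb) (pc x) :=
  pc_flip S x

/-- `0 ∉ S.map castSucc` when `0 ∉ S`. [folklore] -/
theorem zero_not_mem_map_castSuccEmb {S : Finset (Fin (n + 1))} (h0 : (0 : Fin (n + 1)) ∉ S) :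
    (0 : Fin (n + 2)) ∉ S.map Fin.castSuccEmb := by
  simp only [Finset.mem_map, Fin.castSuccEmb_apply, not_exists, not_and]
  intro j hj hj0
  rw [Fin.castSucc_eq_zero_iff] at hj0
  exact h0 (hj0 ▸ hj)

/-- **`τ₊` and the middle reflections**: for `0 ∉ S`, `R_S ∘ τ₊ = τ₊ ∘ flipSet S`. [folklore] -/
theorem postLoop_negCoords_tauP {S : Finset (Fin (n + 1))} (h0 : (0 : Fin (n + 1)) ∉ S) :
    postLoop (negCoords (S.map Fin.castSuccEmb)) (negCoords_pole (zero_not_mem_map_castSuccEmb h0)) tauP =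
      flipLoop S tauP :=
  GenLoop.ext _ _ fun t => by
    rw [postLoop_apply, flipLoop_apply, tauP_apply, tauP_apply,
      ← gMap_negCoords_of_not_mem (zero_not_mem_map_castSuccEmb h0), ← pc_flipSet]
    congr 2
    funext j
    by_cases hj : j = 0
    · subst hj
      simp [flipSet, sqL, h0]
    · obtain ⟨j', rfl⟩ := Fin.exists_succ_eq.mpr hj
      simp [flipSet, sqL_succ]

/-- The sign change `M` of all coordinates but the first fixes `e₀`. [folklore] -/
theorem negCoords_erase_zero_pole :
    negCoords ((Finset.univ : Finset (Fin (n + 2))).erase 0) (pole (n + 1)) = pole (n + 1) :=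
  negCoords_pole (by simp)

/-- **`τ₋ = M ∘ τ₊ ∘ flip₀`** with `M = -ρ_{e₀}` (sign change of all coordinates but the
first): `(1 + t₀)/2 = 1 - (1 - t₀)/2`, `pc ∘ flip₀ = R₀ ∘ pc` and `G ∘ R₀ = M ∘ G`. [folklore] -/
theorem tauM_eq_postLoop :
    (tauM (n := n)) = postLoop (negCoords ((Finset.univ : Finset (Fin (n + 2))).erase 0))
      negCoords_erase_zero_pole (GenLoop.symmAt 0 tauP) :=
  GenLoop.ext _ _ fun t => by
    rw [postLoop_apply, symmAt_zero_apply, tauM_apply, tauP_apply, ← gMap_negCoords_zero,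
      ← pc_flipSet_zero]
    congr 2
    funext j
    by_cases hj : j = 0
    · subst hj
      apply Subtype.ext
      simp only [flipSet, Finset.mem_singleton, if_true, sqR_zero, coe_halfR, sqL_zero,
        unitInterval.coe_symm_eq, coe_halfL, flipArg]
      ring
    · obtain ⟨j', rfl⟩ := Fin.exists_succ_eq.mpr hj
      simp [flipSet, Fin.succ_ne_zero, flipArg]

/-- The middle coordinates `{1, …, m - 1}` of `Sᵐ`, `m = n + 1`, as the image of the nonzero
cube coordinates. [folklore] -/
theorem singleton_last_union_map :
    {Fin.last (n + 1)} ∪ ((Finset.univ : Finset (Fin (n + 1))).erase 0).map Fin.castSuccEmb =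
      (Finset.univ : Finset (Fin (n + 2))).erase 0 := by
  ext i
  simp only [Finset.mem_union, Finset.mem_singleton, Finset.mem_map, Finset.mem_erase,
    Finset.mem_univ, and_true, Fin.castSuccEmb_apply, ne_eq]
  constructor
  · rintro (h | ⟨j, hj, rfl⟩)
    · rw [h]; exact (ne_of_lt Fin.last_pos).symm
    · rwa [Fin.castSucc_eq_zero_iff]
  · intro h
    refine Fin.lastCases (fun _ => Or.inl rfl) (fun j hj => Or.inr ⟨j, ?_, rfl⟩) i h
    rwa [Fin.castSucc_eq_zero_iff] at hj

/-- `e_m` is not a middle coordinate. [folklore] -/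
theorem disjoint_singleton_last_map :
    Disjoint ({Fin.last (n + 1)} : Finset (Fin (n + 2)))
      (((Finset.univ : Finset (Fin (n + 1))).erase 0).map Fin.castSuccEmb) := by
  rw [Finset.disjoint_singleton_left]
  simp only [Finset.mem_map, Finset.mem_erase, Finset.mem_univ, and_true, Fin.castSuccEmb_apply,
    not_exists, not_and]
  exact fun j _ => (Fin.castSucc_lt_last j).ne

/-- The reflection in `e_m` fixes `e₀`. [folklore] -/
theorem negCoords_last_pole : negCoords {Fin.last (n + 1)} (pole (n + 1)) = pole (n + 1) :=
  negCoords_pole (by rw [Finset.mem_singleton]; exact ne_of_lt Fin.last_pos)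

/-- `M = R_m ∘ R_mid` on based loops. [folklore] -/
theorem postLoop_erase_zero_eq (q : Ω^ (Fin (n + 1)) (sphere (0 : EuclideanSpace ℝ (Fin (n + 2))) 1) (pole (n + 1))) :
    postLoop (negCoords ((Finset.univ : Finset (Fin (n + 2))).erase 0)) negCoords_erase_zero_pole q =
      postLoop (negCoords {Fin.last (n + 1)}) negCoords_last_pole
        (postLoop (negCoords (((Finset.univ : Finset (Fin (n + 1))).erase 0).map Fin.castSuccEmb))
          (negCoords_pole (zero_not_mem_map_castSuccEmb (by simp))) q) :=
  GenLoop.ext _ _ fun t => by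
    rw [postLoop_apply, postLoop_apply, postLoop_apply,
      negCoords_negCoords_of_disjoint disjoint_singleton_last_map, singleton_last_union_map]

/-- `swap ∘ swap = id` on `Sᵐ`. [folklore] -/
theorem swapCoords_swapCoords (u : sphere (0 : EuclideanSpace ℝ (Fin (n + 2))) 1) :
    swapCoords (swapCoords u) = u :=
  sphere_ext fun i => by rw [ofLp_swapCoords, ofLp_swapCoords, Equiv.swap_apply_self]

/-- **The swapped collapse** `swap ∘ pc : (Iᵐ, ∂Iᵐ) → (Sᵐ, e₀)`, a based loop at `e₀` on which
the reflection in `e_m` acts as the cube reflection in `x₀`. [folklore] -/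
def swapLoop : Ω^ (Fin (n + 1)) (sphere (0 : EuclideanSpace ℝ (Fin (n + 2))) 1) (pole (n + 1)) :=
  ⟨swapCoords.comp pc, fun t ht => by
    change swapCoords (pc t) = pole (n + 1)
    rw [pc_eq_lastPt_of_mem ht, swapCoords_lastPt]⟩

/-- `swapLoop` pointwise. [folklore] -/
@[simp] theorem swapLoop_apply (t : Fin (n + 1) → I) : swapLoop t = swapCoords (pc t) := rfl

/-- `R_m ∘ (swap ∘ pc) = (swap ∘ pc) ∘ flip₀`. [folklore] -/
theorem postLoop_negCoords_last_swapLoop :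
    postLoop (negCoords {Fin.last (n + 1)}) negCoords_last_pole (swapLoop (n := n)) =
      GenLoop.symmAt 0 swapLoop :=
  GenLoop.ext _ _ fun t => by
    rw [postLoop_apply, swapLoop_apply, negCoords_last_swapCoords, ← pc_flipSet_zero, flipSet_zero_eq]
    rfl

/-- **The swapped collapse is essential** (`m ≥ 2`): it is onto and identifies only boundary
points, and `πₘ(Sᵐ) ≠ 0`. [cite: HatcherAT2002, §4.1 p. 340 with Cor. 4.25] -/
theorem cls_swapLoop_ne_one (hn : 1 ≤ n) : cls (swapLoop (n := n)) ≠ 1 := by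
  refine cls_ne_one_of_surjective _ (fun z => ?_) (fun t t' h => ?_)
    (nontrivial_homotopyGroup_sphere (m := n + 1) (by omega) _)
  · obtain ⟨x, hx, -⟩ := exists_pc_eq (swapCoords z)
    exact ⟨x, by rw [swapLoop_apply, hx, swapCoords_swapCoords]⟩
  · refine pc_eq_pc_imp ?_
    rw [swapLoop_apply, swapLoop_apply] at h
    rw [← swapCoords_swapCoords (pc t), h, swapCoords_swapCoords]

/-- **The reflection in `e_m` acts by inversion on `πₘ(Sᵐ, e₀) ≅ ℤ`** (`m = n + 1 ≥ 2`): it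
inverts the essential class of the swapped collapse, hence every class
(`map_eq_inv_of_map_eq_inv`). [cite: HatcherAT2002, §4.1 pp. 340–342 with Cor. 4.25] -/
theorem postHom_negCoords_last_eq_inv (hn : 1 ≤ n)
    (e' : HomotopyGroup (Fin (n + 1)) (sphere (0 : EuclideanSpace ℝ (Fin (n + 2))) 1) (pole (n + 1)) ≃*
      Multiplicative ℤ)
    (v : HomotopyGroup (Fin (n + 1)) (sphere (0 : EuclideanSpace ℝ (Fin (n + 2))) 1) (pole (n + 1))) :
    postHom (negCoords {Fin.last (n + 1)}) negCoords_last_pole v = v⁻¹ :=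
  map_eq_inv_of_map_eq_inv e' _ (cls_swapLoop_ne_one hn)
    (postHom_cls_eq_inv_of_eq_symmAt _ negCoords_last_pole 0 swapLoop
      postLoop_negCoords_last_swapLoop) v

/-- **`[τ₋] = [τ₊]` for `m = n + 1` even** (`n` even): `[τ₋] = M_*[τ₊ reversed] = (M_*[τ₊])⁻¹`,
and `M_* = (R_m)_* ∘ (R_mid)_*` with `(R_mid)_*[τ₊] = [τ₊]^{(-1)ⁿ} = [τ₊]` (cube reflections) and
`(R_m)_* = ·⁻¹`. This is the sign computation behind `deg(p' T) = 1 + (-1)^{m+1} = 2`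
(Steenrod §23.4) for `m + 1` even. [cite: Steenrod1951, §23.4] -/
theorem cls_tauM_eq (hn : Even n) (hn1 : 1 ≤ n)
    (e' : HomotopyGroup (Fin (n + 1)) (sphere (0 : EuclideanSpace ℝ (Fin (n + 2))) 1) (pole (n + 1)) ≃*
      Multiplicative ℤ) :
    cls (tauM (n := n)) = cls tauP := by
  have h3 : cls (flipLoop ((Finset.univ : Finset (Fin (n + 1))).erase 0) tauP) = cls tauP := by
    rw [cls_flipLoop, Finset.card_erase_of_mem (Finset.mem_univ _), Finset.card_univ, Fintype.card_fin,
      Nat.add_sub_cancel, Even.neg_one_pow hn, zpow_one]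
  rw [tauM_eq_postLoop, ← postHom_cls, ← cls_inv 0, map_inv, postHom_cls, postLoop_erase_zero_eq,
    ← postHom_cls, postHom_negCoords_last_eq_inv hn1 e', inv_inv,
    postLoop_negCoords_tauP (by simp), h3]

/-- **`τ₊` is onto and identifies only boundary points**, part 1: onto (`G` maps the lower
hemisphere onto `Sᵐ`, `pc` maps `{x₀ ≤ ½}` onto the lower hemisphere). [folklore] -/
theorem tauP_surjective : Function.Surjective (tauP (n := n)) := fun z => by
  obtain ⟨u, hu0, huz⟩ := exists_gMap_eq z
  obtain ⟨x, hxu, hx0⟩ := exists_pc_eq u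
  have hx : (x 0 : ℝ) ≤ 1 / 2 := hx0 (by rw [Fin.castSucc_zero]; exact hu0)
  let t0 : I := ⟨2 * (x 0 : ℝ), by linarith [(x 0).2.1], by linarith⟩
  refine ⟨Function.update x 0 t0, ?_⟩
  rw [tauP_apply]
  have : sqL (Function.update x 0 t0) = x := by
    rw [sqL, Function.update_idem, Function.update_eq_self_iff, Function.update_self]
    apply Subtype.ext
    rw [coe_halfL]
    change 2 * (x 0 : ℝ) / 2 = x 0
    ring
  rw [this, hxu, huz]

/-- **`τ₊` is onto and identifies only boundary points**, part 2. [folklore] -/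
theorem tauP_eq_imp {t t' : Fin (n + 1) → I} (h : tauP t = tauP t') :
    t = t' ∨ (t ∈ Cube.boundary (Fin (n + 1)) ∧ t' ∈ Cube.boundary (Fin (n + 1))) := by
  rw [tauP_apply, tauP_apply] at h
  have h0 : WithLp.ofLp (pc (sqL t) : EuclideanSpace ℝ (Fin (n + 2))) 0 ≤ 0 := by
    rw [← Fin.castSucc_zero]; exact pcVec_sqL_zero_nonpos t
  have h0' : WithLp.ofLp (pc (sqL t') : EuclideanSpace ℝ (Fin (n + 2))) 0 ≤ 0 := by
    rw [← Fin.castSucc_zero]; exact pcVec_sqL_zero_nonpos t'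
  rcases gMap_eq_gMap_imp h h0 h0' with h1 | ⟨h1, h2⟩
  · rcases pc_eq_pc_imp h1 with h2 | ⟨h2, h3⟩
    · exact Or.inl (sqL_injective h2)
    · exact Or.inr ⟨mem_boundary_of_sqL_mem h2, mem_boundary_of_sqL_mem h3⟩
  · refine Or.inr ⟨mem_boundary_of_pcVec_sqL_zero ?_, mem_boundary_of_pcVec_sqL_zero ?_⟩
    · rw [Fin.castSucc_zero]; exact h1
    · rw [Fin.castSucc_zero]; exact h2

/-- **`τ₊` is essential** (`m = n + 1 ≥ 2`). [cite: HatcherAT2002, §4.1 p. 340 with Cor. 4.25] -/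
theorem cls_tauP_ne_one (hn : 1 ≤ n) : cls (tauP (n := n)) ≠ 1 :=
  cls_ne_one_of_surjective _ tauP_surjective (fun _ _ h => tauP_eq_imp h)
    (nontrivial_homotopyGroup_sphere (m := n + 1) (by omega) _)

/-- **`[p' ∘ T] = [τ₊]²`** for `n` even. [cite: Steenrod1951, §23.4] -/
theorem cls_projLoop_tLoop_eq_sq (hn : Even n) (hn1 : 1 ≤ n)
    (e' : HomotopyGroup (Fin (n + 1)) (sphere (0 : EuclideanSpace ℝ (Fin (n + 2))) 1) (pole (n + 1)) ≃*
      Multiplicative ℤ) :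
    cls (projLoop (tLoop (n := n))) = cls tauP ^ 2 := by
  rw [projLoop_tLoop, gpLoop_eq_transAt, ← cls_mul_cls, cls_tauM_eq hn hn1 e', sq]

/-- **`μ[T] ≠ 1`** for `μ = (πₘ(Sᵐ) ≅ ℤ) ∘ p'_*` and `n` even, `n ≥ 1`: Steenrod's
`p'_* Δ ι_{m+1} = 2 ι_m ≠ 0` (§23.4, `m + 1` even) in the present normalisation.
[cite: Steenrod1951, §23.4] -/
theorem mu_cls_tLoop_ne_one (hn : Even n) (hn1 : 1 ≤ n)
    (e' : HomotopyGroup (Fin (n + 1)) (sphere (0 : EuclideanSpace ℝ (Fin (n + 2))) 1) (pole (n + 1)) ≃*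
      Multiplicative ℤ) :
    (e'.toMonoidHom.comp projHom) (cls (tLoop (n := n))) ≠ 1 := by
  intro h
  have h1 : cls (projLoop (tLoop (n := n))) = 1 := by
    apply e'.injective
    rw [map_one]
    exact h
  rw [cls_projLoop_tLoop_eq_sq hn hn1 e', ← zpow_natCast] at h1
  have h2 := eq_zero_of_zpow_eq_one e' (cls_tauP_ne_one hn1) h1
  norm_num at h2

end Loops

/-! ### 4. The explicit normalised lift `Λ` of Steenrod's contraction -/

section Lift

variable {n : ℕ}

/-- `ρ_{(0, v)} = 1 ⊕ ρ_v`: a reflection in a vector of `0 ⊕ ℝᵏ` is the block matrix of the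
reflection in `ℝᵏ`. [folklore] -/
theorem reflMat_cons_zero {k : ℕ} (v : Fin k → ℝ) :
    reflMat (Fin.cons 0 v : Fin (k + 1) → ℝ) = blockSucc (reflMat v) := by
  have hd : (Fin.cons 0 v : Fin (k + 1) → ℝ) ⬝ᵥ Fin.cons 0 v = v ⬝ᵥ v := by
    simp [dotProduct, Fin.sum_univ_succ]
  ext i j
  refine Fin.cases ?_ (fun i' => ?_) i <;> refine Fin.cases ?_ (fun j' => ?_) j
  · simp [reflMat, vecMulVec_apply]
  · simp [reflMat, vecMulVec_apply, (Fin.succ_ne_zero j').symm]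
  · simp [reflMat, vecMulVec_apply, Fin.succ_ne_zero]
  · simp [reflMat, vecMulVec_apply, hd, Matrix.one_apply]

/-- `‖(a, b v)‖² = a² + b²` for a unit vector `v`. [folklore] -/
theorem cons_smul_dotProduct_self {k : ℕ} (a b : ℝ) {v : Fin k → ℝ} (hv : v ⬝ᵥ v = 1) :
    (Fin.cons a (b • v) : Fin (k + 1) → ℝ) ⬝ᵥ Fin.cons a (b • v) = a ^ 2 + b ^ 2 := by
  have h : ∑ i, b * v i * (b * v i) = b ^ 2 * (v ⬝ᵥ v) := by
    rw [dotProduct, Finset.mul_sum]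
    exact Finset.sum_congr rfl fun i _ => by ring
  rw [dotProduct, Fin.sum_univ_succ]
  simp only [Fin.cons_zero, Fin.cons_succ, Pi.smul_apply, smul_eq_mul]
  rw [h, hv]
  ring

/-- `(1 - s)² + s² ≠ 0`. [folklore] -/
theorem one_sub_sq_add_sq_ne_zero (s : ℝ) : (1 - s) ^ 2 + s ^ 2 ≠ 0 := by
  nlinarith [sq_nonneg (1 - 2 * s)]

/-- The path `a(s) = (1 - s) e₀ + s e_{m+1}` in `ℝᵐ⁺² = ℝ ⊕ ℝᵐ⁺¹` (unnormalised; reflections do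
not see the normalisation), from `e₀` to the image of `e_m`. [cite: Steenrod1951, §23.3] -/
def avec (s : I) : Fin (n + 3) → ℝ :=
  Fin.cons (1 - (s : ℝ)) ((s : ℝ) • (Pi.single (Fin.last (n + 1)) 1 : Fin (n + 2) → ℝ))

/-- The family `b(t) = (1 - t₀) e₀ + t₀ · pc(t₁, …)` in `ℝ ⊕ ℝᵐ⁺¹`. [cite: Steenrod1951, §23.3] -/
def bvec (t : Fin (n + 2) → I) : Fin (n + 3) → ℝ :=
  Fin.cons (1 - (t 0 : ℝ)) ((t 0 : ℝ) • pcVec (Fin.tail t))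

/-- `a(s) ≠ 0`. [folklore] -/
theorem avec_dotProduct_self_ne_zero (s : I) : avec (n := n) s ⬝ᵥ avec s ≠ 0 := by
  rw [avec, cons_smul_dotProduct_self _ _ single_last_dotProduct_self]
  exact one_sub_sq_add_sq_ne_zero _

/-- `b(t) ≠ 0`. [folklore] -/
theorem bvec_dotProduct_self_ne_zero (t : Fin (n + 2) → I) : bvec t ⬝ᵥ bvec t ≠ 0 := by
  rw [bvec, cons_smul_dotProduct_self _ _ (pcVec_dotProduct_self _)]
  exact one_sub_sq_add_sq_ne_zero _

/-- `avec` is continuous. [folklore] -/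
theorem continuous_avec : Continuous (avec (n := n)) :=
  Continuous.finCons (continuous_const.sub continuous_subtype_val)
    (continuous_subtype_val.smul continuous_const)

/-- `bvec` is continuous. [folklore] -/
theorem continuous_bvec : Continuous (bvec (n := n)) := by
  have h0 : Continuous fun t : Fin (n + 2) → I => (t 0 : ℝ) :=
    continuous_subtype_val.comp (continuous_apply 0)
  have ht : Continuous fun t : Fin (n + 2) → I => pcVec (Fin.tail t) :=
    continuous_pcVec.comp (continuous_pi fun j => continuous_apply j.succ)
  unfold bvec
  exact Continuous.finCons (continuous_const.sub h0) (h0.smul ht)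

/-- **The explicit normalised lift** `Λ(t) = ρ_{b(t)} ρ_{a(t₀)} ∈ SO(m + 2)`, `m = n + 1`
(Steenrod §23.3: the characteristic map `T_{m+1}` extends over the cone inside `R_{m+1}`; here the
two reflection vectors are moved from `e₀` to `pc(x)` and `e_m`). [cite: Steenrod1951, §23.3] -/
def lamLift : C((Fin (n + 2) → I), Matrix.specialOrthogonalGroup (Fin (n + 3)) ℝ) where
  toFun t := ⟨reflMat (bvec t) * reflMat (avec (t 0)),
    reflMat_mul_reflMat_mem (bvec_dotProduct_self_ne_zero t) (avec_dotProduct_self_ne_zero (t 0))⟩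
  continuous_toFun := Continuous.subtype_mk ((continuous_reflMat continuous_bvec
    bvec_dotProduct_self_ne_zero).mul (continuous_reflMat (continuous_avec.comp (continuous_apply 0))
      fun t => avec_dotProduct_self_ne_zero (t 0))) _

/-- The matrix of `Λ(t)`. [folklore] -/
theorem coe_lamLift (t : Fin (n + 2) → I) : (lamLift t).1 = reflMat (bvec t) * reflMat (avec (t 0)) := rfl

/-- **`Λ = 1` at `t₀ = 0`** (`a = b = e₀`). [cite: Steenrod1951, §23.3] -/
theorem lamLift_eq_one_of_zero {t : Fin (n + 2) → I} (h : t 0 = 0) : lamLift t = 1 := by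
  apply Subtype.ext
  rw [coe_lamLift]
  have hb : bvec t = avec (t 0) := by simp [bvec, avec, h]
  rw [hb, reflMat_mul_self (avec_dotProduct_self_ne_zero _)]
  rfl

/-- **`Λ = 1` over `∂Iᵐ`** (`pc = e_m` there, so `b = a`). [cite: Steenrod1951, §23.3] -/
theorem lamLift_eq_one_of_tail {t : Fin (n + 2) → I} (h : Fin.tail t ∈ Cube.boundary (Fin (n + 1))) :
    lamLift t = 1 := by
  apply Subtype.ext
  rw [coe_lamLift]
  have hb : bvec t = avec (t 0) := by rw [bvec, avec, pcVec_eq_single_of_mem h]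
  rw [hb, reflMat_mul_self (avec_dotProduct_self_ne_zero _)]
  rfl

/-- **`Λ = ι ∘ T` at `t₀ = 1`** (`a = (0, e_m)`, `b = (0, pc x)`, and `ρ_{(0, v)} = 1 ⊕ ρ_v`).
[cite: Steenrod1951, §23.3] -/
theorem lamLift_eq_inclSO_of_one {t : Fin (n + 2) → I} (h : t 0 = 1) :
    lamLift t = inclSO (tLoop (Fin.tail t)) := by
  apply Subtype.ext
  rw [coe_lamLift, coe_inclSO, coe_tLoop, blockSucc_mul]
  have hb : bvec t = Fin.cons 0 (pcVec (Fin.tail t)) := by simp [bvec, h]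
  have ha : avec (t 0) = Fin.cons 0 (Pi.single (Fin.last (n + 1)) 1 : Fin (n + 2) → ℝ) := by
    simp [avec, h]
  rw [hb, ha, reflMat_cons_zero, reflMat_cons_zero]

/-- The based loop `p ∘ Λ : (Iᵐ⁺¹, ∂) → (Sᵐ⁺¹, e₀)` lifted by `Λ` (never analysed beyond its
existence: only its class in `π_{m+1}(Sᵐ⁺¹) ≅ ℤ` enters). [cite: Steenrod1951, §23.3] -/
def lamLoop : Ω^ (Fin (n + 2)) (sphere (0 : EuclideanSpace ℝ (Fin (n + 3))) 1) (pole (n + 2)) :=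
  ⟨⟨fun t => proj (lamLift t), continuous_proj.comp lamLift.continuous⟩, fun t ht => by
    obtain ⟨j, hj⟩ := ht
    change proj (lamLift t) = pole (n + 2)
    by_cases hj0 : j = 0
    · subst hj0
      rcases hj with h | h
      · rw [lamLift_eq_one_of_zero h, proj_one]
      · rw [lamLift_eq_inclSO_of_one h, proj_inclSO]
    · obtain ⟨j', rfl⟩ := Fin.exists_succ_eq.mpr hj0
      rw [lamLift_eq_one_of_tail ⟨j', hj⟩, proj_one]⟩

/-- **`Λ` is a normalised lift of `p ∘ Λ`.** [cite: Steenrod1951, §23.3] -/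
theorem isJLift_lamLift : IsJLift (lamLoop (n := n)) lamLift :=
  ⟨fun _ => rfl, fun _ ht => ht.elim lamLift_eq_one_of_zero lamLift_eq_one_of_tail⟩

/-- **The top of `Λ` is Steenrod's characteristic loop `T`**: `Δ[p ∘ Λ] = [T]`.
[cite: Steenrod1951, §23.3] -/
theorem isTop_lamLift : IsTop (lamLift (n := n)) tLoop := fun y => by
  rw [lamLift_eq_inclSO_of_one (Fin.cons_zero 1 y), Fin.tail_cons]

end Lift

/-! ### 5. The theorem: `ι_*` onto `π_{m+1}(SO(m + 2), 1)` for `m + 1` even; the fact `⇐ π₆(SO(6), 1) = 0` -/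

end EvenSphere

section Main

open EvenSphere SOTransport

variable {n : ℕ}

/-- **Steenrod §23.4, even case: `ι_* : π_{n+2}(SO(n + 2), 1) → π_{n+2}(SO(n + 3), 1)` is onto
for `n` even, `n ≥ 2`** (so for the spheres `S⁴, S⁶, S⁸, …`; `p_* = 0` on `π_{n+2}(SO(n + 3))`
by the vanishing criterion fed with `Λ`, `T` and `μ[T] ≠ 1`, then exactness).
[cite: Steenrod1951, §23.4] -/
theorem surjective_homotopyGroupMap_inclSO_of_even (hn : Even n) (hn1 : 1 ≤ n) :
    Function.Surjective (homotopyGroupMap (N := Fin (n + 2)) (inclSO (N := n + 2)) 1) := by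
  obtain ⟨e⟩ := nonempty_mulEquiv_homotopyGroup_sphere_int (m := n + 2) (by omega) (pole (n + 2))
  obtain ⟨e'⟩ := nonempty_mulEquiv_homotopyGroup_sphere_int (m := n + 1) (by omega) (pole (n + 1))
  exact surjective_homotopyGroupMap_inclSO_of_criterion e isJLift_lamLift isTop_lamLift
    (e'.toMonoidHom.comp projHom) (mu_cls_tLoop_ne_one hn hn1 e')

/-- **`π_{n+2}(SO(n + 2), 1) = 0` implies `π_{n+2}(SO(n + 3), 1) = 0` for `n` even, `n ≥ 2`**
(one rung below the range of the tree's `subsingleton_homotopyGroup_specialOrthogonalGroup_succ_of`,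
which needs `πₖ(Sᴰ) = 0`). [cite: Steenrod1951, §23.4] -/
theorem subsingleton_homotopyGroup_specialOrthogonalGroup_succ_of_even (hn : Even n) (hn1 : 1 ≤ n)
    (h : Subsingleton (π_ (n + 2) (Matrix.specialOrthogonalGroup (Fin (n + 2)) ℝ) 1)) :
    Subsingleton (π_ (n + 2) (Matrix.specialOrthogonalGroup (Fin (n + 3)) ℝ) 1) := by
  obtain ⟨e⟩ := nonempty_mulEquiv_homotopyGroup_sphere_int (m := n + 2) (by omega) (pole (n + 2))
  obtain ⟨e'⟩ := nonempty_mulEquiv_homotopyGroup_sphere_int (m := n + 1) (by omega) (pole (n + 1))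
  exact subsingleton_homotopyGroup_succ_of_criterion e isJLift_lamLift isTop_lamLift
    (e'.toMonoidHom.comp projHom) (mu_cls_tLoop_ne_one hn hn1 e') h

/-- **`π₆(SO(6), 1) = 0` implies the named fact `Bott1959_sphereMapsToStableFramesExtend_six`**:
`π₆(SO(6)) → π₆(SO(7))` is onto (this file, `n = 4`), `π₆(SO(7)) → π₆(SO(8))` is onto
(`…Seven.lean`), and the fact is `π₆(SO(8), 1) = 0` (`…Orthogonal.lean`). The hypothesis is the
first genuinely non-elementary input (`SO(6) ≅ SU(4)/{±1}`, `π₆(SU(4)) = π₆(U) = 0`: complex Bott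
periodicity; Bott 1959 §1: `π₆(O) = 0`). [cite: Bott1959, §1, Corollary to Theorem II, (1.5), p. 315] [cite: Steenrod1951, §23.4] -/
theorem Bott1959_sphereMapsToStableFramesExtend_six_of_specialOrthogonalGroup_six
    (h : Subsingleton (π_ 6 (Matrix.specialOrthogonalGroup (Fin 6) ℝ) 1)) :
    Bott1959_sphereMapsToStableFramesExtend_six :=
  Bott1959_sphereMapsToStableFramesExtend_six_of_specialOrthogonalGroup_seven
    (subsingleton_homotopyGroup_specialOrthogonalGroup_succ_of_even (n := 4) ⟨2, rfl⟩ (by norm_num) h)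

end Main

end Literature.Topology.FourManifolds

end
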